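import Literature.NumberTheory.Connes2026.AnnulusFamilyRealShift
import Literature.NumberTheory.Connes2026.AnnulusCorrectionLimit
import Mathlib.Analysis.Normed.Group.Tannery
import HarnessLib

/-!
# Connes 1999 Thm VII.4 for `k = ℚ`, `S = {∞} ∪ P` (`K_S`-invariant picture): the named fact
# `Connes1999_thm_VII_4_rat` PROVED — several primes by induction on `P` with a decoupled family

LABEL (line 1): RH-FREE literature (theorems only; NO definition, NO named fact).  bears_on: LADDER-RH
W-C/W-P (C1 named-fact debt), cell `rh-crit`, sub-cell cc, overflow row O1 — discharges the Literature fact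
`Literature.NumberTheory.Connes2026.Connes1999_thm_VII_4_rat` (the `S`-local trace formula of Connes 1999,
Thm VII.4, for `k = ℚ` on `K_S`-invariant test functions) through the door
`Connes1999_thm_VII_4_rat_of_annulusCorrection`.  WHAT THIS IS NOT: any claim about positivity, Weil's
criterion or RH (Thm VII.4 is an unconditional asymptotic trace formula; RH is the separate, open, global trace
formula / positivity statement of Connes 1999 §VII–VIII).

Sources.  A. Connes, Selecta Math. 5 (1999) [`Connes1999`], §VII Thm 4 and its proof, eqs. (29)–(33)
(held text `paper:arxiv-math_9811068`, p0013): the several-places case is reduced to one place at a time by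
`log|u| = Σ_{v ∈ S} log|u_v|` (eqs. (30)–(32)); M. Reed, B. Simon I (1972) [`ReedSimon1972`], Thm. VI.18,
VI.24 (trace-class / diagonal series).

## The argument (printed proof, `K_S`-invariant shadow)

Write `P_Λ = cutoffProj Λ`, `P̂⁰_M = dualCutoffProj ∅ M`, `ϑ_t = scalingUnitary t`, `u_A = twistUnitary A`,
`K_A(Λ) = u_A^* P_Λ u_A − P_Λ` (the annulus correction), `d_g(X, e) = ⟨e, ϑ(g) X e⟩ = diagCoeff g X e`.
For a bounded `B` consider the DECOUPLED FAMILY of diagonal series `Σ_i d_g(P̂⁰_M B ϑ_t, f_i)` over Hilbert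
bases `(f_i)` of `L²(ℝ)_ev`, `M, t ∈ ℝ`, and the package "(B) absolutely summable with a bound uniform in
`M, t, (f_i)`; (I) basis independent; (L) convergent as `M → ∞` to `V(t)`".  Then:
* the package is stable under `B ↦ B₁ ± B₂`, `B ↦ ϑ_{−τ} B ϑ_τ` (same `V`; `P̂⁰_M ϑ_{−τ} = ϑ_{−τ} P̂⁰_{Me^{−τ}}`
  and diagonal series are transported along `f ↦ ϑ_τ f`), and under the GEOMETRIC RESUMMATION
  `B ↦ B' = Σ_{(α,β)} (1 − a⁻¹) a^{−(α+β)/2} ϑ_{α log a} B ϑ_{−β log a}` of the one-prime analysis, with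
  `V'(t) = Σ_{(α,β)} (1 − a⁻¹) a^{−(α+β)/2} V(t + (α − β) log a)` (Tannery's theorem; eqs. (29)–(33));
* `B = Q₀ = P_1 − P_{1/a}` has the package with `V(t) = log a · g(−t)` (`family_real`, the one-prime analysis),
  whence `K_{{a}}(1) = Q₀' − Q₀` has it with `V(t) = ∫′_{ℚ_a^*} g_t`, `g_t = g(· − t)` (`connesLocalTerm`);
* for `a ∉ A`: `K_{A ∪ {a}}(1) = K_A(1) + u_A^* K_{{a}}(1) u_A` (`cutoffCorrection_insert`) and, `u_A` commuting
  with the scaling group, `u_A^* K_{{a}}(1) u_A = K_{{a}}(1) − D + D'` with `D = K_A(1) − K_A(1/a)`,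
  `K_A(1/a) = ϑ_{−log a} K_A(1) ϑ_{log a}` — so `D` has the package with `V = V_A − V_A = 0`, hence so does its
  resummation `D'`, and `K_{A ∪ {a}}(1)` has it with `V_A + ∫′_{ℚ_a^*} g_t`: induction on `A` from `K_∅ = 0`;
* finally `P̂⁰_Λ K_P(Λ) = ϑ_{log Λ} (P̂⁰_{Λ²} K_P(1) ϑ_0) ϑ_{−log Λ}`, so the door's hypotheses `hsum`, `hlim`
  (`Λ → ∞ ⇔ M = Λ² → ∞`, `t = 0`, `V(0) = Σ_{p ∈ P} ∫′_{ℚ_p^*} g`) follow, and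
  `Connes1999_thm_VII_4_rat_of_annulusCorrection` gives **`Connes1999_thm_VII_4_rat_holds`**.

No instance, notation or attribute; no `def`; standard axioms only.
-/

noncomputable section

open _root_.MeasureTheory Complex Set Filter Function
open scoped Real Topology ComplexConjugate InnerProductSpace

namespace Literature.NumberTheory.Connes2026

open Literature.NumberTheory.LFunctions Literature.Analysis.OperatorTheory
open Literature.NumberTheory.ConnesConsani
open Literature.NumberTheory.ConnesConsani2024
open Literature.NumberTheory.ConnesConsani2021 hiding cutoffProj cutoffProj_coeFn

/-! ## §1. Scale conjugation of the decoupled terms `P̂⁰_M B ϑ_t` -/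

section Conj

/-- `ϑ_{σ+τ} = ϑ_σ ϑ_τ` (product form). [cite: ConnesConsani2021, §4 eq. (40) p. 15] -/
private theorem scalingUnitary_add_mul' (σ τ : ℝ) :
    scalingUnitary (σ + τ) = scalingUnitary σ * scalingUnitary τ :=
  scalingUnitary_add σ τ

/-- **`P̂⁰_M (ϑ_{α log a} B ϑ_{−β log a}) ϑ_t = ϑ_{α log a} (P̂⁰_{M a^α} B ϑ_{t + (α−β) log a}) ϑ_{−α log a}`**:
each dilated term of the decoupled family is a scale conjugate of the family itself, with ultraviolet
cutoff `M a^α` and shift `t + (α − β) log a`. [cite: Connes1999, §VII proof of Thm 4 eqs. (29)–(33) (arXiv p0013)] -/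
theorem dualCutoffProj_mul_dilated_mul_scalingUnitary (a : ℕ) [hp : Fact a.Prime]
    (B : Lp ℂ 2 (volume : Measure ℝ) →L[ℂ] Lp ℂ 2 (volume : Measure ℝ)) (M t : ℝ) (α β : ℕ) :
    dualCutoffProj ∅ M * (scalingUnitary (α * Real.log a) * B * scalingUnitary (β * (-Real.log a))) *
        scalingUnitary t =
      scalingUnitary (α * Real.log a) *
        (dualCutoffProj ∅ (M * (a : ℝ) ^ α) * B * scalingUnitary (t + ((α : ℝ) - β) * Real.log a)) *
        scalingUnitary (-(α * Real.log a)) := by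
  have ha0 : (0 : ℝ) < a := by exact_mod_cast hp.out.pos
  have hexp : Real.exp (α * Real.log a) = (a : ℝ) ^ α := by rw [Real.exp_nat_mul, Real.exp_log ha0]
  have e1 : dualCutoffProj ∅ M * scalingUnitary (α * Real.log a) =
      scalingUnitary (α * Real.log a) * dualCutoffProj ∅ (M * (a : ℝ) ^ α) := by
    rw [dualCutoffProj_empty_mul_scalingUnitary, hexp]
  have e2 : scalingUnitary (β * (-Real.log a)) * scalingUnitary t =
      scalingUnitary (t + ((α : ℝ) - β) * Real.log a) * scalingUnitary (-(α * Real.log a)) := by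
    rw [← scalingUnitary_add_mul', ← scalingUnitary_add_mul']
    congr 1
    ring
  calc dualCutoffProj ∅ M * (scalingUnitary (α * Real.log a) * B * scalingUnitary (β * (-Real.log a))) *
        scalingUnitary t
      = (dualCutoffProj ∅ M * scalingUnitary (α * Real.log a)) * B *
          (scalingUnitary (β * (-Real.log a)) * scalingUnitary t) := by simp only [mul_assoc]
    _ = (scalingUnitary (α * Real.log a) * dualCutoffProj ∅ (M * (a : ℝ) ^ α)) * B *
          (scalingUnitary (t + ((α : ℝ) - β) * Real.log a) * scalingUnitary (-(α * Real.log a))) := by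
        rw [e1, e2]
    _ = scalingUnitary (α * Real.log a) *
        (dualCutoffProj ∅ (M * (a : ℝ) ^ α) * B * scalingUnitary (t + ((α : ℝ) - β) * Real.log a)) *
        scalingUnitary (-(α * Real.log a)) := by simp only [mul_assoc]

/-- The diagonal coefficients of the dilated terms are those of the family along a transported Hilbert basis:
`d_g(P̂⁰_M ϑ_{α log a} B ϑ_{−β log a} ϑ_t, f_i) = d_g(P̂⁰_{M a^α} B ϑ_{t+(α−β) log a}, f'_i)`,
`f' = f.scalingConj (α log a)`. [cite: Connes1999, §VII proof of Thm 4 eqs. (29)–(33) (arXiv p0013)] -/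
theorem diagCoeff_dilated_eq (a : ℕ) [Fact a.Prime] (g : ℝ → ℂ)
    (B : Lp ℂ 2 (volume : Measure ℝ) →L[ℂ] Lp ℂ 2 (volume : Measure ℝ)) (M t : ℝ) (α β : ℕ) {ι : Type*}
    (f : HilbertBasis ι ℂ (evenPart : Submodule ℂ (Lp ℂ 2 (volume : Measure ℝ)))) (i : ι) :
    diagCoeff g (dualCutoffProj ∅ M *
        (scalingUnitary (α * Real.log a) * B * scalingUnitary (β * (-Real.log a))) * scalingUnitary t)
        ((f i : evenPart) : Lp ℂ 2 (volume : Measure ℝ)) =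
      diagCoeff g (dualCutoffProj ∅ (M * (a : ℝ) ^ α) * B * scalingUnitary (t + ((α : ℝ) - β) * Real.log a))
        ((f.scalingConj (α * Real.log a) i : evenPart) : Lp ℂ 2 (volume : Measure ℝ)) := by
  rw [dualCutoffProj_mul_dilated_mul_scalingUnitary, diagCoeff_conj_scalingUnitary]

/-- **`P̂⁰_M (ϑ_{−τ} B ϑ_τ) ϑ_t = ϑ_{−τ} (P̂⁰_{M e^{−τ}} B ϑ_t) ϑ_{τ}`**: a scale conjugate of `B` has the
same decoupled family up to `M ↦ M e^{−τ}` and a transport of the basis. [cite: Connes1999, §VII proof of Thm 4 eq. (29) (arXiv p0013)] -/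
theorem dualCutoffProj_mul_conj_mul_scalingUnitary
    (B : Lp ℂ 2 (volume : Measure ℝ) →L[ℂ] Lp ℂ 2 (volume : Measure ℝ)) (M t τ : ℝ) :
    dualCutoffProj ∅ M * (scalingUnitary (-τ) * B * scalingUnitary τ) * scalingUnitary t =
      scalingUnitary (-τ) * (dualCutoffProj ∅ (M * Real.exp (-τ)) * B * scalingUnitary t) *
        scalingUnitary (-(-τ)) := by
  have e1 : dualCutoffProj ∅ M * scalingUnitary (-τ) =
      scalingUnitary (-τ) * dualCutoffProj ∅ (M * Real.exp (-τ)) :=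
    dualCutoffProj_empty_mul_scalingUnitary M (-τ)
  have e2 : scalingUnitary τ * scalingUnitary t = scalingUnitary t * scalingUnitary (-(-τ)) := by
    rw [← scalingUnitary_add_mul', ← scalingUnitary_add_mul']
    congr 1
    ring
  calc dualCutoffProj ∅ M * (scalingUnitary (-τ) * B * scalingUnitary τ) * scalingUnitary t
      = (dualCutoffProj ∅ M * scalingUnitary (-τ)) * B * (scalingUnitary τ * scalingUnitary t) := by
        simp only [mul_assoc]
    _ = (scalingUnitary (-τ) * dualCutoffProj ∅ (M * Real.exp (-τ))) * B *
          (scalingUnitary t * scalingUnitary (-(-τ))) := by rw [e1, e2]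
    _ = scalingUnitary (-τ) * (dualCutoffProj ∅ (M * Real.exp (-τ)) * B * scalingUnitary t) *
        scalingUnitary (-(-τ)) := by simp only [mul_assoc]

/-- Diagonal form of the previous identity: `d_g(P̂⁰_M ϑ_{−τ} B ϑ_τ ϑ_t, f_i) = d_g(P̂⁰_{Me^{−τ}} B ϑ_t, f'_i)`,
`f' = f.scalingConj (−τ)`. [cite: Connes1999, §VII proof of Thm 4 eq. (29) (arXiv p0013)] -/
theorem diagCoeff_conj_eq (g : ℝ → ℂ)
    (B : Lp ℂ 2 (volume : Measure ℝ) →L[ℂ] Lp ℂ 2 (volume : Measure ℝ)) (M t τ : ℝ) {ι : Type*}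
    (f : HilbertBasis ι ℂ (evenPart : Submodule ℂ (Lp ℂ 2 (volume : Measure ℝ)))) (i : ι) :
    diagCoeff g (dualCutoffProj ∅ M * (scalingUnitary (-τ) * B * scalingUnitary τ) * scalingUnitary t)
        ((f i : evenPart) : Lp ℂ 2 (volume : Measure ℝ)) =
      diagCoeff g (dualCutoffProj ∅ (M * Real.exp (-τ)) * B * scalingUnitary t)
        ((f.scalingConj (-τ) i : evenPart) : Lp ℂ 2 (volume : Measure ℝ)) := by
  rw [dualCutoffProj_mul_conj_mul_scalingUnitary, diagCoeff_conj_scalingUnitary]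

/-- The continuous linear functional `A ↦ d_g(P̂⁰_M A ϑ_t, e) = ⟨e, ϑ(g) P̂⁰_M A ϑ_t e⟩` on `L(L²(ℝ))`. [cite: Connes1999, §VII Thm 4 (arXiv p0013:L1)] -/
theorem diagCoeff_dualCutoffProj_mul_mul_scalingUnitary_eq_clm (g : ℝ → ℂ) (M t : ℝ)
    (e : Lp ℂ 2 (volume : Measure ℝ)) (A : Lp ℂ 2 (volume : Measure ℝ) →L[ℂ] Lp ℂ 2 (volume : Measure ℝ)) :
    diagCoeff g (dualCutoffProj ∅ M * A * scalingUnitary t) e =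
      ((innerSL ℂ e).comp ((scalingOp g ∘L dualCutoffProj ∅ M).comp
        (ContinuousLinearMap.apply ℂ (Lp ℂ 2 (volume : Measure ℝ)) (scalingUnitary t e)))) A := by
  rw [diagCoeff, mul_apply_eq_comp, mul_apply_eq_comp]
  rfl

/-- **Diagonal coefficients of an operator-norm convergent series**: if `Σ_k c_k • F_k = B'` in `L(L²(ℝ))`
then `Σ_k c_k d_g(P̂⁰_M F_k ϑ_t, e) = d_g(P̂⁰_M B' ϑ_t, e)`. [cite: Connes1999, §VII proof of Thm 4 eqs. (29)–(33) (arXiv p0013); ReedSimon1972, Thm. VI.24] -/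
theorem hasSum_diagCoeff_of_hasSum_op (g : ℝ → ℂ) (M t : ℝ) (e : Lp ℂ 2 (volume : Measure ℝ))
    {κ : Type*} {F : κ → (Lp ℂ 2 (volume : Measure ℝ) →L[ℂ] Lp ℂ 2 (volume : Measure ℝ))} {c : κ → ℂ}
    {B' : Lp ℂ 2 (volume : Measure ℝ) →L[ℂ] Lp ℂ 2 (volume : Measure ℝ)}
    (h : HasSum (fun k => c k • F k) B') :
    HasSum (fun k => c k * diagCoeff g (dualCutoffProj ∅ M * F k * scalingUnitary t) e)
      (diagCoeff g (dualCutoffProj ∅ M * B' * scalingUnitary t) e) := by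
  set φ := (innerSL ℂ e).comp ((scalingOp g ∘L dualCutoffProj ∅ M).comp
    (ContinuousLinearMap.apply ℂ (Lp ℂ 2 (volume : Measure ℝ)) (scalingUnitary t e))) with hφ
  have h' := ContinuousLinearMap.hasSum φ h
  have hφ' : ∀ A, φ A = diagCoeff g (dualCutoffProj ∅ M * A * scalingUnitary t) e := fun A =>
    (diagCoeff_dualCutoffProj_mul_mul_scalingUnitary_eq_clm g M t e A).symm
  rw [hφ'] at h'
  refine h'.congr_fun fun k => ?_
  change _ = φ (_ • _)
  rw [map_smul, smul_eq_mul, hφ']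

end Conj

/-! ## §2. The decoupled package `(B), (I), (L)` and its algebra -/

section Package

variable {g : ℝ → ℂ}

/-- **The zero operator has the package with `V = 0`.** [cite: Connes1999, §VII Thm 4 (arXiv p0013:L1)] -/
theorem decoupledFamily_zero (g : ℝ → ℂ) :
    ∃ C : ℝ,
    (∀ (M t : ℝ) (ι : Type) (f : HilbertBasis ι ℂ (evenPart : Submodule ℂ (Lp ℂ 2 (volume : Measure ℝ)))),
      Summable (fun i => ‖diagCoeff g (dualCutoffProj ∅ M * 0 * scalingUnitary t)
        ((f i : evenPart) : Lp ℂ 2 (volume : Measure ℝ))‖) ∧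
      ∑' i, ‖diagCoeff g (dualCutoffProj ∅ M * 0 * scalingUnitary t)
        ((f i : evenPart) : Lp ℂ 2 (volume : Measure ℝ))‖ ≤ C) ∧
    (∀ (M t : ℝ) (ι : Type) (f : HilbertBasis ι ℂ (evenPart : Submodule ℂ (Lp ℂ 2 (volume : Measure ℝ))))
      (ι' : Type) (f' : HilbertBasis ι' ℂ (evenPart : Submodule ℂ (Lp ℂ 2 (volume : Measure ℝ)))),
      ∑' i, diagCoeff g (dualCutoffProj ∅ M * 0 * scalingUnitary t)
          ((f i : evenPart) : Lp ℂ 2 (volume : Measure ℝ)) =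
        ∑' i, diagCoeff g (dualCutoffProj ∅ M * 0 * scalingUnitary t)
          ((f' i : evenPart) : Lp ℂ 2 (volume : Measure ℝ))) ∧
    (∀ (t : ℝ) (ι : Type) (f : HilbertBasis ι ℂ (evenPart : Submodule ℂ (Lp ℂ 2 (volume : Measure ℝ)))),
      Tendsto (fun M : ℝ => ∑' i,
          diagCoeff g (dualCutoffProj ∅ M * 0 * scalingUnitary t)
            ((f i : evenPart) : Lp ℂ 2 (volume : Measure ℝ)))
        atTop (𝓝 0)) := by
  have h0 : ∀ (M t : ℝ) (e : Lp ℂ 2 (volume : Measure ℝ)),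
      diagCoeff g (dualCutoffProj ∅ M * 0 * scalingUnitary t) e = 0 := fun M t e => by
    rw [mul_zero, zero_mul, diagCoeff, zero_apply, map_zero, inner_zero_right]
  refine ⟨0, fun M t ι f => ?_, fun M t ι f ι' f' => ?_, fun t ι f => ?_⟩
  · simp_rw [h0, norm_zero, tsum_zero]
    exact ⟨summable_zero, le_rfl⟩
  · simp_rw [h0, tsum_zero]
  · simp_rw [h0, tsum_zero]
    exact tendsto_const_nhds

/-- Changing the limit function pointwise. [cite: Connes1999, §VII Thm 4 (arXiv p0013:L1)] -/
theorem decoupledFamily_congr {B : Lp ℂ 2 (volume : Measure ℝ) →L[ℂ] Lp ℂ 2 (volume : Measure ℝ)}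
    {V V' : ℝ → ℂ} (hV : ∀ t, V t = V' t)
    (h : ∃ C : ℝ,
    (∀ (M t : ℝ) (ι : Type) (f : HilbertBasis ι ℂ (evenPart : Submodule ℂ (Lp ℂ 2 (volume : Measure ℝ)))),
      Summable (fun i => ‖diagCoeff g (dualCutoffProj ∅ M * B * scalingUnitary t)
        ((f i : evenPart) : Lp ℂ 2 (volume : Measure ℝ))‖) ∧
      ∑' i, ‖diagCoeff g (dualCutoffProj ∅ M * B * scalingUnitary t)
        ((f i : evenPart) : Lp ℂ 2 (volume : Measure ℝ))‖ ≤ C) ∧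
    (∀ (M t : ℝ) (ι : Type) (f : HilbertBasis ι ℂ (evenPart : Submodule ℂ (Lp ℂ 2 (volume : Measure ℝ))))
      (ι' : Type) (f' : HilbertBasis ι' ℂ (evenPart : Submodule ℂ (Lp ℂ 2 (volume : Measure ℝ)))),
      ∑' i, diagCoeff g (dualCutoffProj ∅ M * B * scalingUnitary t)
          ((f i : evenPart) : Lp ℂ 2 (volume : Measure ℝ)) =
        ∑' i, diagCoeff g (dualCutoffProj ∅ M * B * scalingUnitary t)
          ((f' i : evenPart) : Lp ℂ 2 (volume : Measure ℝ))) ∧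
    (∀ (t : ℝ) (ι : Type) (f : HilbertBasis ι ℂ (evenPart : Submodule ℂ (Lp ℂ 2 (volume : Measure ℝ)))),
      Tendsto (fun M : ℝ => ∑' i,
          diagCoeff g (dualCutoffProj ∅ M * B * scalingUnitary t)
            ((f i : evenPart) : Lp ℂ 2 (volume : Measure ℝ)))
        atTop (𝓝 (V t)))) :
    ∃ C : ℝ,
    (∀ (M t : ℝ) (ι : Type) (f : HilbertBasis ι ℂ (evenPart : Submodule ℂ (Lp ℂ 2 (volume : Measure ℝ)))),
      Summable (fun i => ‖diagCoeff g (dualCutoffProj ∅ M * B * scalingUnitary t)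
        ((f i : evenPart) : Lp ℂ 2 (volume : Measure ℝ))‖) ∧
      ∑' i, ‖diagCoeff g (dualCutoffProj ∅ M * B * scalingUnitary t)
        ((f i : evenPart) : Lp ℂ 2 (volume : Measure ℝ))‖ ≤ C) ∧
    (∀ (M t : ℝ) (ι : Type) (f : HilbertBasis ι ℂ (evenPart : Submodule ℂ (Lp ℂ 2 (volume : Measure ℝ))))
      (ι' : Type) (f' : HilbertBasis ι' ℂ (evenPart : Submodule ℂ (Lp ℂ 2 (volume : Measure ℝ)))),
      ∑' i, diagCoeff g (dualCutoffProj ∅ M * B * scalingUnitary t)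
          ((f i : evenPart) : Lp ℂ 2 (volume : Measure ℝ)) =
        ∑' i, diagCoeff g (dualCutoffProj ∅ M * B * scalingUnitary t)
          ((f' i : evenPart) : Lp ℂ 2 (volume : Measure ℝ))) ∧
    (∀ (t : ℝ) (ι : Type) (f : HilbertBasis ι ℂ (evenPart : Submodule ℂ (Lp ℂ 2 (volume : Measure ℝ)))),
      Tendsto (fun M : ℝ => ∑' i,
          diagCoeff g (dualCutoffProj ∅ M * B * scalingUnitary t)
            ((f i : evenPart) : Lp ℂ 2 (volume : Measure ℝ)))
        atTop (𝓝 (V' t))) := by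
  obtain ⟨C, h1, h0, h2⟩ := h
  exact ⟨C, h1, h0, fun t ι f => hV t ▸ h2 t ι f⟩

/-- Changing the operator along an equality. [cite: Connes1999, §VII Thm 4 (arXiv p0013:L1)] -/
theorem decoupledFamily_congr_op {B B' : Lp ℂ 2 (volume : Measure ℝ) →L[ℂ] Lp ℂ 2 (volume : Measure ℝ)}
    {V : ℝ → ℂ} (hBB' : B = B')
    (h : ∃ C : ℝ,
    (∀ (M t : ℝ) (ι : Type) (f : HilbertBasis ι ℂ (evenPart : Submodule ℂ (Lp ℂ 2 (volume : Measure ℝ)))),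
      Summable (fun i => ‖diagCoeff g (dualCutoffProj ∅ M * B * scalingUnitary t)
        ((f i : evenPart) : Lp ℂ 2 (volume : Measure ℝ))‖) ∧
      ∑' i, ‖diagCoeff g (dualCutoffProj ∅ M * B * scalingUnitary t)
        ((f i : evenPart) : Lp ℂ 2 (volume : Measure ℝ))‖ ≤ C) ∧
    (∀ (M t : ℝ) (ι : Type) (f : HilbertBasis ι ℂ (evenPart : Submodule ℂ (Lp ℂ 2 (volume : Measure ℝ))))
      (ι' : Type) (f' : HilbertBasis ι' ℂ (evenPart : Submodule ℂ (Lp ℂ 2 (volume : Measure ℝ)))),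
      ∑' i, diagCoeff g (dualCutoffProj ∅ M * B * scalingUnitary t)
          ((f i : evenPart) : Lp ℂ 2 (volume : Measure ℝ)) =
        ∑' i, diagCoeff g (dualCutoffProj ∅ M * B * scalingUnitary t)
          ((f' i : evenPart) : Lp ℂ 2 (volume : Measure ℝ))) ∧
    (∀ (t : ℝ) (ι : Type) (f : HilbertBasis ι ℂ (evenPart : Submodule ℂ (Lp ℂ 2 (volume : Measure ℝ)))),
      Tendsto (fun M : ℝ => ∑' i,
          diagCoeff g (dualCutoffProj ∅ M * B * scalingUnitary t)
            ((f i : evenPart) : Lp ℂ 2 (volume : Measure ℝ)))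
        atTop (𝓝 (V t)))) :
    ∃ C : ℝ,
    (∀ (M t : ℝ) (ι : Type) (f : HilbertBasis ι ℂ (evenPart : Submodule ℂ (Lp ℂ 2 (volume : Measure ℝ)))),
      Summable (fun i => ‖diagCoeff g (dualCutoffProj ∅ M * B' * scalingUnitary t)
        ((f i : evenPart) : Lp ℂ 2 (volume : Measure ℝ))‖) ∧
      ∑' i, ‖diagCoeff g (dualCutoffProj ∅ M * B' * scalingUnitary t)
        ((f i : evenPart) : Lp ℂ 2 (volume : Measure ℝ))‖ ≤ C) ∧
    (∀ (M t : ℝ) (ι : Type) (f : HilbertBasis ι ℂ (evenPart : Submodule ℂ (Lp ℂ 2 (volume : Measure ℝ))))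
      (ι' : Type) (f' : HilbertBasis ι' ℂ (evenPart : Submodule ℂ (Lp ℂ 2 (volume : Measure ℝ)))),
      ∑' i, diagCoeff g (dualCutoffProj ∅ M * B' * scalingUnitary t)
          ((f i : evenPart) : Lp ℂ 2 (volume : Measure ℝ)) =
        ∑' i, diagCoeff g (dualCutoffProj ∅ M * B' * scalingUnitary t)
          ((f' i : evenPart) : Lp ℂ 2 (volume : Measure ℝ))) ∧
    (∀ (t : ℝ) (ι : Type) (f : HilbertBasis ι ℂ (evenPart : Submodule ℂ (Lp ℂ 2 (volume : Measure ℝ)))),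
      Tendsto (fun M : ℝ => ∑' i,
          diagCoeff g (dualCutoffProj ∅ M * B' * scalingUnitary t)
            ((f i : evenPart) : Lp ℂ 2 (volume : Measure ℝ)))
        atTop (𝓝 (V t))) := by
  subst hBB'
  exact h

/-- **The package is stable under `B ↦ B₁ + B₂`** (limits `V₁ + V₂`). [cite: Connes1999, §VII proof of Thm 4 eqs. (30)–(32) (arXiv p0013); ReedSimon1972, Thm. VI.24] -/
theorem decoupledFamily_add {B₁ B₂ : Lp ℂ 2 (volume : Measure ℝ) →L[ℂ] Lp ℂ 2 (volume : Measure ℝ)} {V₁ V₂ : ℝ → ℂ}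
    (h₁ : ∃ C : ℝ,
    (∀ (M t : ℝ) (ι : Type) (f : HilbertBasis ι ℂ (evenPart : Submodule ℂ (Lp ℂ 2 (volume : Measure ℝ)))),
      Summable (fun i => ‖diagCoeff g (dualCutoffProj ∅ M * B₁ * scalingUnitary t)
        ((f i : evenPart) : Lp ℂ 2 (volume : Measure ℝ))‖) ∧
      ∑' i, ‖diagCoeff g (dualCutoffProj ∅ M * B₁ * scalingUnitary t)
        ((f i : evenPart) : Lp ℂ 2 (volume : Measure ℝ))‖ ≤ C) ∧
    (∀ (M t : ℝ) (ι : Type) (f : HilbertBasis ι ℂ (evenPart : Submodule ℂ (Lp ℂ 2 (volume : Measure ℝ))))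
      (ι' : Type) (f' : HilbertBasis ι' ℂ (evenPart : Submodule ℂ (Lp ℂ 2 (volume : Measure ℝ)))),
      ∑' i, diagCoeff g (dualCutoffProj ∅ M * B₁ * scalingUnitary t)
          ((f i : evenPart) : Lp ℂ 2 (volume : Measure ℝ)) =
        ∑' i, diagCoeff g (dualCutoffProj ∅ M * B₁ * scalingUnitary t)
          ((f' i : evenPart) : Lp ℂ 2 (volume : Measure ℝ))) ∧
    (∀ (t : ℝ) (ι : Type) (f : HilbertBasis ι ℂ (evenPart : Submodule ℂ (Lp ℂ 2 (volume : Measure ℝ)))),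
      Tendsto (fun M : ℝ => ∑' i,
          diagCoeff g (dualCutoffProj ∅ M * B₁ * scalingUnitary t)
            ((f i : evenPart) : Lp ℂ 2 (volume : Measure ℝ)))
        atTop (𝓝 (V₁ t))))
    (h₂ : ∃ C : ℝ,
    (∀ (M t : ℝ) (ι : Type) (f : HilbertBasis ι ℂ (evenPart : Submodule ℂ (Lp ℂ 2 (volume : Measure ℝ)))),
      Summable (fun i => ‖diagCoeff g (dualCutoffProj ∅ M * B₂ * scalingUnitary t)
        ((f i : evenPart) : Lp ℂ 2 (volume : Measure ℝ))‖) ∧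
      ∑' i, ‖diagCoeff g (dualCutoffProj ∅ M * B₂ * scalingUnitary t)
        ((f i : evenPart) : Lp ℂ 2 (volume : Measure ℝ))‖ ≤ C) ∧
    (∀ (M t : ℝ) (ι : Type) (f : HilbertBasis ι ℂ (evenPart : Submodule ℂ (Lp ℂ 2 (volume : Measure ℝ))))
      (ι' : Type) (f' : HilbertBasis ι' ℂ (evenPart : Submodule ℂ (Lp ℂ 2 (volume : Measure ℝ)))),
      ∑' i, diagCoeff g (dualCutoffProj ∅ M * B₂ * scalingUnitary t)
          ((f i : evenPart) : Lp ℂ 2 (volume : Measure ℝ)) =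
        ∑' i, diagCoeff g (dualCutoffProj ∅ M * B₂ * scalingUnitary t)
          ((f' i : evenPart) : Lp ℂ 2 (volume : Measure ℝ))) ∧
    (∀ (t : ℝ) (ι : Type) (f : HilbertBasis ι ℂ (evenPart : Submodule ℂ (Lp ℂ 2 (volume : Measure ℝ)))),
      Tendsto (fun M : ℝ => ∑' i,
          diagCoeff g (dualCutoffProj ∅ M * B₂ * scalingUnitary t)
            ((f i : evenPart) : Lp ℂ 2 (volume : Measure ℝ)))
        atTop (𝓝 (V₂ t)))) :
    ∃ C : ℝ,
    (∀ (M t : ℝ) (ι : Type) (f : HilbertBasis ι ℂ (evenPart : Submodule ℂ (Lp ℂ 2 (volume : Measure ℝ)))),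
      Summable (fun i => ‖diagCoeff g (dualCutoffProj ∅ M * (B₁ + B₂) * scalingUnitary t)
        ((f i : evenPart) : Lp ℂ 2 (volume : Measure ℝ))‖) ∧
      ∑' i, ‖diagCoeff g (dualCutoffProj ∅ M * (B₁ + B₂) * scalingUnitary t)
        ((f i : evenPart) : Lp ℂ 2 (volume : Measure ℝ))‖ ≤ C) ∧
    (∀ (M t : ℝ) (ι : Type) (f : HilbertBasis ι ℂ (evenPart : Submodule ℂ (Lp ℂ 2 (volume : Measure ℝ))))
      (ι' : Type) (f' : HilbertBasis ι' ℂ (evenPart : Submodule ℂ (Lp ℂ 2 (volume : Measure ℝ)))),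
      ∑' i, diagCoeff g (dualCutoffProj ∅ M * (B₁ + B₂) * scalingUnitary t)
          ((f i : evenPart) : Lp ℂ 2 (volume : Measure ℝ)) =
        ∑' i, diagCoeff g (dualCutoffProj ∅ M * (B₁ + B₂) * scalingUnitary t)
          ((f' i : evenPart) : Lp ℂ 2 (volume : Measure ℝ))) ∧
    (∀ (t : ℝ) (ι : Type) (f : HilbertBasis ι ℂ (evenPart : Submodule ℂ (Lp ℂ 2 (volume : Measure ℝ)))),
      Tendsto (fun M : ℝ => ∑' i,
          diagCoeff g (dualCutoffProj ∅ M * (B₁ + B₂) * scalingUnitary t)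
            ((f i : evenPart) : Lp ℂ 2 (volume : Measure ℝ)))
        atTop (𝓝 (V₁ t + V₂ t))) := by
  obtain ⟨C₁, h11, h10, h12⟩ := h₁
  obtain ⟨C₂, h21, h20, h22⟩ := h₂
  have hsplit : ∀ (M t : ℝ) (e : Lp ℂ 2 (volume : Measure ℝ)),
      diagCoeff g (dualCutoffProj ∅ M * (B₁ + B₂) * scalingUnitary t) e =
        diagCoeff g (dualCutoffProj ∅ M * B₁ * scalingUnitary t) e +
          diagCoeff g (dualCutoffProj ∅ M * B₂ * scalingUnitary t) e := fun M t e => by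
    rw [mul_add, add_mul, diagCoeff_add]
  refine ⟨C₁ + C₂, fun M t ι f => ?_, fun M t ι f ι' f' => ?_, fun t ι f => ?_⟩
  · obtain ⟨hs1, hb1⟩ := h11 M t ι f
    obtain ⟨hs2, hb2⟩ := h21 M t ι f
    simp_rw [hsplit]
    have hs : Summable fun i => ‖diagCoeff g (dualCutoffProj ∅ M * B₁ * scalingUnitary t) ((f i : evenPart) : Lp ℂ 2 (volume : Measure ℝ)) +
        diagCoeff g (dualCutoffProj ∅ M * B₂ * scalingUnitary t) ((f i : evenPart) : Lp ℂ 2 (volume : Measure ℝ))‖ :=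
      Summable.of_nonneg_of_le (fun _ => norm_nonneg _) (fun i => norm_add_le _ _) (hs1.add hs2)
    refine ⟨hs, (hs.tsum_le_tsum (fun i => norm_add_le _ _) (hs1.add hs2)).trans ?_⟩
    rw [hs1.tsum_add hs2]
    exact add_le_add hb1 hb2
  · simp_rw [hsplit]
    rw [(Summable.of_norm (h11 M t ι f).1).tsum_add (Summable.of_norm (h21 M t ι f).1),
      (Summable.of_norm (h11 M t ι' f').1).tsum_add (Summable.of_norm (h21 M t ι' f').1),
      h10 M t ι f ι' f', h20 M t ι f ι' f']
  · simp_rw [hsplit]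
    refine ((h12 t ι f).add (h22 t ι f)).congr fun M => ?_
    exact ((Summable.of_norm (h11 M t ι f).1).tsum_add (Summable.of_norm (h21 M t ι f).1)).symm

/-- **The package is stable under `B ↦ B₁ - B₂`** (limits `V₁ - V₂`). [cite: Connes1999, §VII proof of Thm 4 eqs. (30)–(32) (arXiv p0013); ReedSimon1972, Thm. VI.24] -/
theorem decoupledFamily_sub {B₁ B₂ : Lp ℂ 2 (volume : Measure ℝ) →L[ℂ] Lp ℂ 2 (volume : Measure ℝ)} {V₁ V₂ : ℝ → ℂ}
    (h₁ : ∃ C : ℝ,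
    (∀ (M t : ℝ) (ι : Type) (f : HilbertBasis ι ℂ (evenPart : Submodule ℂ (Lp ℂ 2 (volume : Measure ℝ)))),
      Summable (fun i => ‖diagCoeff g (dualCutoffProj ∅ M * B₁ * scalingUnitary t)
        ((f i : evenPart) : Lp ℂ 2 (volume : Measure ℝ))‖) ∧
      ∑' i, ‖diagCoeff g (dualCutoffProj ∅ M * B₁ * scalingUnitary t)
        ((f i : evenPart) : Lp ℂ 2 (volume : Measure ℝ))‖ ≤ C) ∧
    (∀ (M t : ℝ) (ι : Type) (f : HilbertBasis ι ℂ (evenPart : Submodule ℂ (Lp ℂ 2 (volume : Measure ℝ))))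
      (ι' : Type) (f' : HilbertBasis ι' ℂ (evenPart : Submodule ℂ (Lp ℂ 2 (volume : Measure ℝ)))),
      ∑' i, diagCoeff g (dualCutoffProj ∅ M * B₁ * scalingUnitary t)
          ((f i : evenPart) : Lp ℂ 2 (volume : Measure ℝ)) =
        ∑' i, diagCoeff g (dualCutoffProj ∅ M * B₁ * scalingUnitary t)
          ((f' i : evenPart) : Lp ℂ 2 (volume : Measure ℝ))) ∧
    (∀ (t : ℝ) (ι : Type) (f : HilbertBasis ι ℂ (evenPart : Submodule ℂ (Lp ℂ 2 (volume : Measure ℝ)))),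
      Tendsto (fun M : ℝ => ∑' i,
          diagCoeff g (dualCutoffProj ∅ M * B₁ * scalingUnitary t)
            ((f i : evenPart) : Lp ℂ 2 (volume : Measure ℝ)))
        atTop (𝓝 (V₁ t))))
    (h₂ : ∃ C : ℝ,
    (∀ (M t : ℝ) (ι : Type) (f : HilbertBasis ι ℂ (evenPart : Submodule ℂ (Lp ℂ 2 (volume : Measure ℝ)))),
      Summable (fun i => ‖diagCoeff g (dualCutoffProj ∅ M * B₂ * scalingUnitary t)
        ((f i : evenPart) : Lp ℂ 2 (volume : Measure ℝ))‖) ∧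
      ∑' i, ‖diagCoeff g (dualCutoffProj ∅ M * B₂ * scalingUnitary t)
        ((f i : evenPart) : Lp ℂ 2 (volume : Measure ℝ))‖ ≤ C) ∧
    (∀ (M t : ℝ) (ι : Type) (f : HilbertBasis ι ℂ (evenPart : Submodule ℂ (Lp ℂ 2 (volume : Measure ℝ))))
      (ι' : Type) (f' : HilbertBasis ι' ℂ (evenPart : Submodule ℂ (Lp ℂ 2 (volume : Measure ℝ)))),
      ∑' i, diagCoeff g (dualCutoffProj ∅ M * B₂ * scalingUnitary t)
          ((f i : evenPart) : Lp ℂ 2 (volume : Measure ℝ)) =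
        ∑' i, diagCoeff g (dualCutoffProj ∅ M * B₂ * scalingUnitary t)
          ((f' i : evenPart) : Lp ℂ 2 (volume : Measure ℝ))) ∧
    (∀ (t : ℝ) (ι : Type) (f : HilbertBasis ι ℂ (evenPart : Submodule ℂ (Lp ℂ 2 (volume : Measure ℝ)))),
      Tendsto (fun M : ℝ => ∑' i,
          diagCoeff g (dualCutoffProj ∅ M * B₂ * scalingUnitary t)
            ((f i : evenPart) : Lp ℂ 2 (volume : Measure ℝ)))
        atTop (𝓝 (V₂ t)))) :
    ∃ C : ℝ,
    (∀ (M t : ℝ) (ι : Type) (f : HilbertBasis ι ℂ (evenPart : Submodule ℂ (Lp ℂ 2 (volume : Measure ℝ)))),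
      Summable (fun i => ‖diagCoeff g (dualCutoffProj ∅ M * (B₁ - B₂) * scalingUnitary t)
        ((f i : evenPart) : Lp ℂ 2 (volume : Measure ℝ))‖) ∧
      ∑' i, ‖diagCoeff g (dualCutoffProj ∅ M * (B₁ - B₂) * scalingUnitary t)
        ((f i : evenPart) : Lp ℂ 2 (volume : Measure ℝ))‖ ≤ C) ∧
    (∀ (M t : ℝ) (ι : Type) (f : HilbertBasis ι ℂ (evenPart : Submodule ℂ (Lp ℂ 2 (volume : Measure ℝ))))
      (ι' : Type) (f' : HilbertBasis ι' ℂ (evenPart : Submodule ℂ (Lp ℂ 2 (volume : Measure ℝ)))),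
      ∑' i, diagCoeff g (dualCutoffProj ∅ M * (B₁ - B₂) * scalingUnitary t)
          ((f i : evenPart) : Lp ℂ 2 (volume : Measure ℝ)) =
        ∑' i, diagCoeff g (dualCutoffProj ∅ M * (B₁ - B₂) * scalingUnitary t)
          ((f' i : evenPart) : Lp ℂ 2 (volume : Measure ℝ))) ∧
    (∀ (t : ℝ) (ι : Type) (f : HilbertBasis ι ℂ (evenPart : Submodule ℂ (Lp ℂ 2 (volume : Measure ℝ)))),
      Tendsto (fun M : ℝ => ∑' i,
          diagCoeff g (dualCutoffProj ∅ M * (B₁ - B₂) * scalingUnitary t)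
            ((f i : evenPart) : Lp ℂ 2 (volume : Measure ℝ)))
        atTop (𝓝 (V₁ t - V₂ t))) := by
  obtain ⟨C₁, h11, h10, h12⟩ := h₁
  obtain ⟨C₂, h21, h20, h22⟩ := h₂
  have hsplit : ∀ (M t : ℝ) (e : Lp ℂ 2 (volume : Measure ℝ)),
      diagCoeff g (dualCutoffProj ∅ M * (B₁ - B₂) * scalingUnitary t) e =
        diagCoeff g (dualCutoffProj ∅ M * B₁ * scalingUnitary t) e -
          diagCoeff g (dualCutoffProj ∅ M * B₂ * scalingUnitary t) e := fun M t e => by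
    rw [mul_sub, sub_mul, diagCoeff_sub]
  refine ⟨C₁ + C₂, fun M t ι f => ?_, fun M t ι f ι' f' => ?_, fun t ι f => ?_⟩
  · obtain ⟨hs1, hb1⟩ := h11 M t ι f
    obtain ⟨hs2, hb2⟩ := h21 M t ι f
    simp_rw [hsplit]
    have hs : Summable fun i => ‖diagCoeff g (dualCutoffProj ∅ M * B₁ * scalingUnitary t) ((f i : evenPart) : Lp ℂ 2 (volume : Measure ℝ)) -
        diagCoeff g (dualCutoffProj ∅ M * B₂ * scalingUnitary t) ((f i : evenPart) : Lp ℂ 2 (volume : Measure ℝ))‖ :=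
      Summable.of_nonneg_of_le (fun _ => norm_nonneg _) (fun i => norm_sub_le _ _) (hs1.add hs2)
    refine ⟨hs, (hs.tsum_le_tsum (fun i => norm_sub_le _ _) (hs1.add hs2)).trans ?_⟩
    rw [hs1.tsum_add hs2]
    exact add_le_add hb1 hb2
  · simp_rw [hsplit]
    rw [(Summable.of_norm (h11 M t ι f).1).tsum_sub (Summable.of_norm (h21 M t ι f).1),
      (Summable.of_norm (h11 M t ι' f').1).tsum_sub (Summable.of_norm (h21 M t ι' f').1),
      h10 M t ι f ι' f', h20 M t ι f ι' f']
  · simp_rw [hsplit]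
    refine ((h12 t ι f).sub (h22 t ι f)).congr fun M => ?_
    exact ((Summable.of_norm (h11 M t ι f).1).tsum_sub (Summable.of_norm (h21 M t ι f).1)).symm

/-- **The package is stable under scale conjugation `B ↦ ϑ_{−τ} B ϑ_τ`** (same limits): the terms are
those of `B` at `M e^{−τ}` along the transported basis `f.scalingConj (−τ)`, and `M e^{−τ} → ∞`. [cite: Connes1999, §VII proof of Thm 4 eq. (29) (arXiv p0013)] -/
theorem decoupledFamily_conj {B : Lp ℂ 2 (volume : Measure ℝ) →L[ℂ] Lp ℂ 2 (volume : Measure ℝ)} {V : ℝ → ℂ} (τ : ℝ)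
    (h : ∃ C : ℝ,
    (∀ (M t : ℝ) (ι : Type) (f : HilbertBasis ι ℂ (evenPart : Submodule ℂ (Lp ℂ 2 (volume : Measure ℝ)))),
      Summable (fun i => ‖diagCoeff g (dualCutoffProj ∅ M * B * scalingUnitary t)
        ((f i : evenPart) : Lp ℂ 2 (volume : Measure ℝ))‖) ∧
      ∑' i, ‖diagCoeff g (dualCutoffProj ∅ M * B * scalingUnitary t)
        ((f i : evenPart) : Lp ℂ 2 (volume : Measure ℝ))‖ ≤ C) ∧
    (∀ (M t : ℝ) (ι : Type) (f : HilbertBasis ι ℂ (evenPart : Submodule ℂ (Lp ℂ 2 (volume : Measure ℝ))))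
      (ι' : Type) (f' : HilbertBasis ι' ℂ (evenPart : Submodule ℂ (Lp ℂ 2 (volume : Measure ℝ)))),
      ∑' i, diagCoeff g (dualCutoffProj ∅ M * B * scalingUnitary t)
          ((f i : evenPart) : Lp ℂ 2 (volume : Measure ℝ)) =
        ∑' i, diagCoeff g (dualCutoffProj ∅ M * B * scalingUnitary t)
          ((f' i : evenPart) : Lp ℂ 2 (volume : Measure ℝ))) ∧
    (∀ (t : ℝ) (ι : Type) (f : HilbertBasis ι ℂ (evenPart : Submodule ℂ (Lp ℂ 2 (volume : Measure ℝ)))),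
      Tendsto (fun M : ℝ => ∑' i,
          diagCoeff g (dualCutoffProj ∅ M * B * scalingUnitary t)
            ((f i : evenPart) : Lp ℂ 2 (volume : Measure ℝ)))
        atTop (𝓝 (V t)))) :
    ∃ C : ℝ,
    (∀ (M t : ℝ) (ι : Type) (f : HilbertBasis ι ℂ (evenPart : Submodule ℂ (Lp ℂ 2 (volume : Measure ℝ)))),
      Summable (fun i => ‖diagCoeff g (dualCutoffProj ∅ M * (scalingUnitary (-τ) * B * scalingUnitary τ) * scalingUnitary t)
        ((f i : evenPart) : Lp ℂ 2 (volume : Measure ℝ))‖) ∧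
      ∑' i, ‖diagCoeff g (dualCutoffProj ∅ M * (scalingUnitary (-τ) * B * scalingUnitary τ) * scalingUnitary t)
        ((f i : evenPart) : Lp ℂ 2 (volume : Measure ℝ))‖ ≤ C) ∧
    (∀ (M t : ℝ) (ι : Type) (f : HilbertBasis ι ℂ (evenPart : Submodule ℂ (Lp ℂ 2 (volume : Measure ℝ))))
      (ι' : Type) (f' : HilbertBasis ι' ℂ (evenPart : Submodule ℂ (Lp ℂ 2 (volume : Measure ℝ)))),
      ∑' i, diagCoeff g (dualCutoffProj ∅ M * (scalingUnitary (-τ) * B * scalingUnitary τ) * scalingUnitary t)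
          ((f i : evenPart) : Lp ℂ 2 (volume : Measure ℝ)) =
        ∑' i, diagCoeff g (dualCutoffProj ∅ M * (scalingUnitary (-τ) * B * scalingUnitary τ) * scalingUnitary t)
          ((f' i : evenPart) : Lp ℂ 2 (volume : Measure ℝ))) ∧
    (∀ (t : ℝ) (ι : Type) (f : HilbertBasis ι ℂ (evenPart : Submodule ℂ (Lp ℂ 2 (volume : Measure ℝ)))),
      Tendsto (fun M : ℝ => ∑' i,
          diagCoeff g (dualCutoffProj ∅ M * (scalingUnitary (-τ) * B * scalingUnitary τ) * scalingUnitary t)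
            ((f i : evenPart) : Lp ℂ 2 (volume : Measure ℝ)))
        atTop (𝓝 (V t))) := by
  obtain ⟨C, h1, h0, h2⟩ := h
  have heq : ∀ (M t : ℝ) (ι : Type) (f : HilbertBasis ι ℂ (evenPart : Submodule ℂ (Lp ℂ 2 (volume : Measure ℝ)))) (i : ι),
      diagCoeff g (dualCutoffProj ∅ M * (scalingUnitary (-τ) * B * scalingUnitary τ) * scalingUnitary t)
          ((f i : evenPart) : Lp ℂ 2 (volume : Measure ℝ)) =
        diagCoeff g (dualCutoffProj ∅ (M * Real.exp (-τ)) * B * scalingUnitary t)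
          ((f.scalingConj (-τ) i : evenPart) : Lp ℂ 2 (volume : Measure ℝ)) :=
    fun M t ι f i => diagCoeff_conj_eq g B M t τ f i
  refine ⟨C, fun M t ι f => ?_, fun M t ι f ι' f' => ?_, fun t ι f => ?_⟩
  · simp_rw [heq]
    exact h1 _ _ ι _
  · simp_rw [heq]
    exact h0 _ _ ι _ ι' _
  · simp_rw [heq]
    exact (h2 t ι (f.scalingConj (-τ))).comp (tendsto_id.atTop_mul_const (Real.exp_pos (-τ)))

/-- **Geometric resummation of a package** (the heart of the one-prime analysis, eqs. (29)–(33)).  If `B`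
has the package with limits `V` and `B' = Σ_{(α,β) ∈ ℕ²} (1 − a⁻¹) a^{−(α+β)/2} ϑ_{α log a} B ϑ_{−β log a}`
(operator-norm convergent), then `B'` has the package with limits
`V'(t) = Σ_{(α,β)} (1 − a⁻¹) a^{−(α+β)/2} V(t + (α − β) log a)`: each dilated term is the family at
`(M a^α, t + (α−β) log a)` along a transported basis (§1), the double series over `((α,β), i)` is absolutely
convergent with sum `≤ (Σ 2a^{−(α+β)/2}) C` uniformly, and the limit is Tannery's theorem. [cite: Connes1999, §VII proof of Thm 4 eqs. (29)–(33) (arXiv p0013); ReedSimon1972, Thm. VI.24, PDF p. 199] -/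
theorem decoupledFamily_resum (a : ℕ) [hp : Fact a.Prime] {B B' : Lp ℂ 2 (volume : Measure ℝ) →L[ℂ] Lp ℂ 2 (volume : Measure ℝ)} {V : ℝ → ℂ}
    (hB : ∃ C : ℝ,
    (∀ (M t : ℝ) (ι : Type) (f : HilbertBasis ι ℂ (evenPart : Submodule ℂ (Lp ℂ 2 (volume : Measure ℝ)))),
      Summable (fun i => ‖diagCoeff g (dualCutoffProj ∅ M * B * scalingUnitary t)
        ((f i : evenPart) : Lp ℂ 2 (volume : Measure ℝ))‖) ∧
      ∑' i, ‖diagCoeff g (dualCutoffProj ∅ M * B * scalingUnitary t)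
        ((f i : evenPart) : Lp ℂ 2 (volume : Measure ℝ))‖ ≤ C) ∧
    (∀ (M t : ℝ) (ι : Type) (f : HilbertBasis ι ℂ (evenPart : Submodule ℂ (Lp ℂ 2 (volume : Measure ℝ))))
      (ι' : Type) (f' : HilbertBasis ι' ℂ (evenPart : Submodule ℂ (Lp ℂ 2 (volume : Measure ℝ)))),
      ∑' i, diagCoeff g (dualCutoffProj ∅ M * B * scalingUnitary t)
          ((f i : evenPart) : Lp ℂ 2 (volume : Measure ℝ)) =
        ∑' i, diagCoeff g (dualCutoffProj ∅ M * B * scalingUnitary t)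
          ((f' i : evenPart) : Lp ℂ 2 (volume : Measure ℝ))) ∧
    (∀ (t : ℝ) (ι : Type) (f : HilbertBasis ι ℂ (evenPart : Submodule ℂ (Lp ℂ 2 (volume : Measure ℝ)))),
      Tendsto (fun M : ℝ => ∑' i,
          diagCoeff g (dualCutoffProj ∅ M * B * scalingUnitary t)
            ((f i : evenPart) : Lp ℂ 2 (volume : Measure ℝ)))
        atTop (𝓝 (V t))))
    (hB' : HasSum (fun ab : ℕ × ℕ => ((1 - (a : ℂ)⁻¹) * (((Real.sqrt a)⁻¹ : ℝ) : ℂ) ^ (ab.1 + ab.2)) •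
        (scalingUnitary (ab.1 * Real.log a) * B * scalingUnitary (ab.2 * (-Real.log a)))) B') :
    ∃ C : ℝ,
    (∀ (M t : ℝ) (ι : Type) (f : HilbertBasis ι ℂ (evenPart : Submodule ℂ (Lp ℂ 2 (volume : Measure ℝ)))),
      Summable (fun i => ‖diagCoeff g (dualCutoffProj ∅ M * B' * scalingUnitary t)
        ((f i : evenPart) : Lp ℂ 2 (volume : Measure ℝ))‖) ∧
      ∑' i, ‖diagCoeff g (dualCutoffProj ∅ M * B' * scalingUnitary t)
        ((f i : evenPart) : Lp ℂ 2 (volume : Measure ℝ))‖ ≤ C) ∧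
    (∀ (M t : ℝ) (ι : Type) (f : HilbertBasis ι ℂ (evenPart : Submodule ℂ (Lp ℂ 2 (volume : Measure ℝ))))
      (ι' : Type) (f' : HilbertBasis ι' ℂ (evenPart : Submodule ℂ (Lp ℂ 2 (volume : Measure ℝ)))),
      ∑' i, diagCoeff g (dualCutoffProj ∅ M * B' * scalingUnitary t)
          ((f i : evenPart) : Lp ℂ 2 (volume : Measure ℝ)) =
        ∑' i, diagCoeff g (dualCutoffProj ∅ M * B' * scalingUnitary t)
          ((f' i : evenPart) : Lp ℂ 2 (volume : Measure ℝ))) ∧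
    (∀ (t : ℝ) (ι : Type) (f : HilbertBasis ι ℂ (evenPart : Submodule ℂ (Lp ℂ 2 (volume : Measure ℝ)))),
      Tendsto (fun M : ℝ => ∑' i,
          diagCoeff g (dualCutoffProj ∅ M * B' * scalingUnitary t)
            ((f i : evenPart) : Lp ℂ 2 (volume : Measure ℝ)))
        atTop (𝓝 (∑' ab : ℕ × ℕ, ((1 - (a : ℂ)⁻¹) * (((Real.sqrt a)⁻¹ : ℝ) : ℂ) ^ (ab.1 + ab.2)) *
          V (t + ((ab.1 : ℝ) - ab.2) * Real.log a)))) := by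
  obtain ⟨C, hB1, hB0, hB2⟩ := hB
  have ha0 : (0 : ℝ) < a := by exact_mod_cast hp.out.pos
  -- the weights and their absolute summability
  set r : ℝ := (Real.sqrt a)⁻¹ with hr
  have hr0 : 0 ≤ r := inv_nonneg.mpr (Real.sqrt_nonneg _)
  have hr1 : r < 1 := by
    rw [hr, inv_lt_one_iff₀]; right
    rw [show (1 : ℝ) = Real.sqrt 1 by simp]
    exact Real.sqrt_lt_sqrt zero_le_one (by exact_mod_cast hp.out.one_lt)
  set w : ℕ × ℕ → ℂ := fun ab => (1 - (a : ℂ)⁻¹) * ((r : ℝ) : ℂ) ^ (ab.1 + ab.2) with hw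
  have hwn : ∀ ab : ℕ × ℕ, ‖w ab‖ ≤ 2 * (r ^ ab.1 * r ^ ab.2) := fun ab => by
    rw [hw]
    simp only
    rw [norm_mul, norm_pow, Complex.norm_real, Real.norm_eq_abs, abs_of_nonneg hr0, pow_add]
    refine mul_le_mul_of_nonneg_right ?_ (mul_nonneg (pow_nonneg hr0 _) (pow_nonneg hr0 _))
    calc ‖(1 : ℂ) - (a : ℂ)⁻¹‖ ≤ ‖(1 : ℂ)‖ + ‖(a : ℂ)⁻¹‖ := norm_sub_le _ _
      _ ≤ 1 + 1 := by
          rw [norm_one, norm_inv, Complex.norm_natCast]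
          gcongr
          exact inv_le_one_of_one_le₀ (by exact_mod_cast hp.out.one_lt.le)
      _ = 2 := by norm_num
  have hwsum : Summable fun ab : ℕ × ℕ => 2 * (r ^ ab.1 * r ^ ab.2) :=
    ((summable_geometric_of_lt_one hr0 hr1).mul_of_nonneg (summable_geometric_of_lt_one hr0 hr1)
      (fun _ => pow_nonneg hr0 _) (fun _ => pow_nonneg hr0 _)).mul_left 2
  -- the key computation at fixed `M, t, (f_i)`
  have key : ∀ (M t : ℝ) (ι : Type) (f : HilbertBasis ι ℂ (evenPart : Submodule ℂ (Lp ℂ 2 (volume : Measure ℝ)))),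
      (Summable (fun i => ‖diagCoeff g (dualCutoffProj ∅ M * B' * scalingUnitary t) ((f i : evenPart) : Lp ℂ 2 (volume : Measure ℝ))‖) ∧
        ∑' i, ‖diagCoeff g (dualCutoffProj ∅ M * B' * scalingUnitary t) ((f i : evenPart) : Lp ℂ 2 (volume : Measure ℝ))‖ ≤
          (∑' ab : ℕ × ℕ, 2 * (r ^ ab.1 * r ^ ab.2)) * C) ∧
      HasSum (fun ab : ℕ × ℕ => w ab * ∑' i, diagCoeff g (dualCutoffProj ∅ (M * (a : ℝ) ^ ab.1) * B *
          scalingUnitary (t + ((ab.1 : ℝ) - ab.2) * Real.log a)) ((f i : evenPart) : Lp ℂ 2 (volume : Measure ℝ)))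
        (∑' i, diagCoeff g (dualCutoffProj ∅ M * B' * scalingUnitary t) ((f i : evenPart) : Lp ℂ 2 (volume : Measure ℝ))) := by
    intro M t ι f
    set D : ℕ × ℕ → ι → ℂ := fun ab i => diagCoeff g (dualCutoffProj ∅ M *
      (scalingUnitary (ab.1 * Real.log a) * B * scalingUnitary (ab.2 * (-Real.log a))) * scalingUnitary t)
      ((f i : evenPart) : Lp ℂ 2 (volume : Measure ℝ)) with hD
    set S : ℕ × ℕ → ℂ := fun ab => ∑' i, diagCoeff g (dualCutoffProj ∅ (M * (a : ℝ) ^ ab.1) * B *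
        scalingUnitary (t + ((ab.1 : ℝ) - ab.2) * Real.log a)) ((f i : evenPart) : Lp ℂ 2 (volume : Measure ℝ)) with hS
    -- rows: the dilated terms are the family along a transported basis
    have hDrow : ∀ ab : ℕ × ℕ, (Summable (fun i => ‖D ab i‖) ∧ ∑' i, ‖D ab i‖ ≤ C) ∧
        HasSum (fun i => D ab i) (S ab) := fun ab => by
      have h1 := hB1 (M * (a : ℝ) ^ ab.1) (t + ((ab.1 : ℝ) - ab.2) * Real.log a) ι
        (f.scalingConj (ab.1 * Real.log a))
      have h0 := hB0 (M * (a : ℝ) ^ ab.1) (t + ((ab.1 : ℝ) - ab.2) * Real.log a) ι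
        (f.scalingConj (ab.1 * Real.log a)) ι f
      have hDeq : ∀ i, D ab i = diagCoeff g (dualCutoffProj ∅ (M * (a : ℝ) ^ ab.1) * B *
          scalingUnitary (t + ((ab.1 : ℝ) - ab.2) * Real.log a))
          ((f.scalingConj (ab.1 * Real.log a) i : evenPart) : Lp ℂ 2 (volume : Measure ℝ)) :=
        fun i => by rw [hD]; exact diagCoeff_dilated_eq a g B M t ab.1 ab.2 f i
      simp_rw [hDeq]
      refine ⟨h1, ?_⟩
      rw [hS]
      simp only
      rw [← h0]
      exact (Summable.of_norm h1.1).hasSum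
    -- joint absolute summability over `(ℕ × ℕ) × ι`
    have hG : Summable fun abi : (ℕ × ℕ) × ι => ‖w abi.1‖ * ‖D abi.1 abi.2‖ := by
      refine (summable_prod_of_nonneg fun _ => mul_nonneg (norm_nonneg _) (norm_nonneg _)).2 ⟨fun ab => ?_, ?_⟩
      · exact ((hDrow ab).1.1.mul_left ‖w ab‖).congr fun i => rfl
      · refine Summable.of_nonneg_of_le (fun _ => tsum_nonneg fun _ => mul_nonneg (norm_nonneg _) (norm_nonneg _))
          (fun ab => ?_) (hwsum.mul_right C)
        simp only
        rw [tsum_mul_left]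
        exact mul_le_mul (hwn ab) (hDrow ab).1.2 (tsum_nonneg fun _ => norm_nonneg _)
          (mul_nonneg zero_le_two (mul_nonneg (pow_nonneg hr0 _) (pow_nonneg hr0 _)))
    have hGs := hG.hasSum
    have hG' : Summable fun iab : ι × (ℕ × ℕ) => ‖w iab.2‖ * ‖D iab.2 iab.1‖ :=
      (Equiv.prodComm ι (ℕ × ℕ)).summable_iff.mpr hG
    have hrowi : ∀ i, Summable fun ab : ℕ × ℕ => ‖w ab‖ * ‖D ab i‖ := fun i =>
      ((summable_prod_of_nonneg fun _ => mul_nonneg (norm_nonneg _) (norm_nonneg _)).1 hG').1 i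
    have hSi : Summable fun i => ∑' ab : ℕ × ℕ, ‖w ab‖ * ‖D ab i‖ :=
      ((summable_prod_of_nonneg fun _ => mul_nonneg (norm_nonneg _) (norm_nonneg _)).1 hG').2
    have hG1 : HasSum (fun ab : ℕ × ℕ => ∑' i, ‖w ab‖ * ‖D ab i‖)
        (∑' abi : (ℕ × ℕ) × ι, ‖w abi.1‖ * ‖D abi.1 abi.2‖) :=
      hGs.prod_fiberwise fun ab => ((hDrow ab).1.1.mul_left ‖w ab‖).hasSum
    have hG2 : HasSum (fun i => ∑' ab : ℕ × ℕ, ‖w ab‖ * ‖D ab i‖)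
        (∑' abi : (ℕ × ℕ) × ι, ‖w abi.1‖ * ‖D abi.1 abi.2‖) :=
      ((Equiv.prodComm ι (ℕ × ℕ)).hasSum_iff.mpr hGs).prod_fiberwise fun i => (hrowi i).hasSum
    -- the series itself, and its two iterated sums
    have hF : Summable fun abi : (ℕ × ℕ) × ι => w abi.1 * D abi.1 abi.2 :=
      Summable.of_norm (hG.congr fun abi => (norm_mul _ _).symm)
    have hFs := hF.hasSum
    have h1 : HasSum (fun ab : ℕ × ℕ => w ab * S ab) (∑' abi : (ℕ × ℕ) × ι, w abi.1 * D abi.1 abi.2) :=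
      hFs.prod_fiberwise fun ab => (hDrow ab).2.mul_left (w ab)
    have hfib : ∀ i, HasSum (fun ab : ℕ × ℕ => w ab * D ab i)
        (diagCoeff g (dualCutoffProj ∅ M * B' * scalingUnitary t) ((f i : evenPart) : Lp ℂ 2 (volume : Measure ℝ))) := fun i =>
      hasSum_diagCoeff_of_hasSum_op g M t ((f i : evenPart) : Lp ℂ 2 (volume : Measure ℝ)) hB'
    have h2 : HasSum (fun i => diagCoeff g (dualCutoffProj ∅ M * B' * scalingUnitary t) ((f i : evenPart) : Lp ℂ 2 (volume : Measure ℝ)))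
        (∑' abi : (ℕ × ℕ) × ι, w abi.1 * D abi.1 abi.2) :=
      ((Equiv.prodComm ι (ℕ × ℕ)).hasSum_iff.mpr hFs).prod_fiberwise hfib
    -- norms
    have hnorm : ∀ i, ‖diagCoeff g (dualCutoffProj ∅ M * B' * scalingUnitary t) ((f i : evenPart) : Lp ℂ 2 (volume : Measure ℝ))‖ ≤
        ∑' ab : ℕ × ℕ, ‖w ab‖ * ‖D ab i‖ := fun i => by
      rw [← (hfib i).tsum_eq]
      refine (norm_tsum_le_tsum_norm ((hrowi i).congr fun ab => (norm_mul _ _).symm)).trans (le_of_eq ?_)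
      exact tsum_congr fun ab => norm_mul _ _
    have hsum1 : Summable fun i => ‖diagCoeff g (dualCutoffProj ∅ M * B' * scalingUnitary t) ((f i : evenPart) : Lp ℂ 2 (volume : Measure ℝ))‖ :=
      Summable.of_nonneg_of_le (fun _ => norm_nonneg _) hnorm hSi
    have hbound : ∑' i, ‖diagCoeff g (dualCutoffProj ∅ M * B' * scalingUnitary t) ((f i : evenPart) : Lp ℂ 2 (volume : Measure ℝ))‖ ≤
        (∑' ab : ℕ × ℕ, 2 * (r ^ ab.1 * r ^ ab.2)) * C := by
      calc ∑' i, ‖diagCoeff g (dualCutoffProj ∅ M * B' * scalingUnitary t) ((f i : evenPart) : Lp ℂ 2 (volume : Measure ℝ))‖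
          ≤ ∑' i, ∑' ab : ℕ × ℕ, ‖w ab‖ * ‖D ab i‖ := hsum1.tsum_le_tsum hnorm hSi
        _ = ∑' ab : ℕ × ℕ, ∑' i, ‖w ab‖ * ‖D ab i‖ := by rw [hG2.tsum_eq, hG1.tsum_eq]
        _ ≤ ∑' ab : ℕ × ℕ, 2 * (r ^ ab.1 * r ^ ab.2) * C := by
            refine hG1.summable.tsum_le_tsum (fun ab => ?_) (hwsum.mul_right C)
            rw [tsum_mul_left]
            exact mul_le_mul (hwn ab) (hDrow ab).1.2 (tsum_nonneg fun _ => norm_nonneg _)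
              (mul_nonneg zero_le_two (mul_nonneg (pow_nonneg hr0 _) (pow_nonneg hr0 _)))
        _ = (∑' ab : ℕ × ℕ, 2 * (r ^ ab.1 * r ^ ab.2)) * C := tsum_mul_right
    refine ⟨⟨hsum1, hbound⟩, ?_⟩
    rw [h2.tsum_eq]
    exact h1
  -- the three clauses
  refine ⟨(∑' ab : ℕ × ℕ, 2 * (r ^ ab.1 * r ^ ab.2)) * C, fun M t ι f => (key M t ι f).1,
    fun M t ι f ι' f' => ?_, fun t ι f => ?_⟩
  · rw [← (key M t ι f).2.tsum_eq, ← (key M t ι' f').2.tsum_eq]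
    exact tsum_congr fun ab => by rw [hB0 _ _ ι f ι' f']
  · -- Tannery's theorem over `(α, β)`
    have hlim : Tendsto (fun M : ℝ => ∑' ab : ℕ × ℕ, w ab * ∑' i,
          diagCoeff g (dualCutoffProj ∅ (M * (a : ℝ) ^ ab.1) * B *
            scalingUnitary (t + ((ab.1 : ℝ) - ab.2) * Real.log a)) ((f i : evenPart) : Lp ℂ 2 (volume : Measure ℝ)))
        atTop (𝓝 (∑' ab : ℕ × ℕ, w ab * V (t + ((ab.1 : ℝ) - ab.2) * Real.log a))) := by
      refine tendsto_tsum_of_dominated_convergence (bound := fun ab => 2 * (r ^ ab.1 * r ^ ab.2) * C)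
        (hwsum.mul_right C) (fun ab => ?_) (Eventually.of_forall fun M ab => ?_)
      · refine Tendsto.const_mul (w ab) ?_
        have hM : Tendsto (fun M : ℝ => M * (a : ℝ) ^ ab.1) atTop atTop :=
          tendsto_id.atTop_mul_const (pow_pos ha0 _)
        exact (hB2 (t + ((ab.1 : ℝ) - ab.2) * Real.log a) ι f).comp hM
      · rw [norm_mul]
        obtain ⟨h1, h2⟩ := hB1 (M * (a : ℝ) ^ ab.1) (t + ((ab.1 : ℝ) - ab.2) * Real.log a) ι f
        exact mul_le_mul (hwn ab) ((norm_tsum_le_tsum_norm h1).trans h2) (norm_nonneg _)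
          (mul_nonneg zero_le_two (mul_nonneg (pow_nonneg hr0 _) (pow_nonneg hr0 _)))
    exact hlim.congr fun M => (key M t ι f).2.tsum_eq

end Package

/-! ## §3. One prime: the package of `K_{{a}}(1) = u_a^* P_1 u_a − P_1` -/

section OnePrime

variable {g : ℝ → ℂ}

/-- **The annulus correction of one prime has the package, with limits `∫′_{ℚ_a^*} g(· − t)`**:
`K_{{a}}(1) + Q₀ = Σ_{(α,β)} (1 − a⁻¹)a^{−(α+β)/2} ϑ_{α log a} Q₀ ϑ_{−β log a}`
(`hasSum_cutoffCorrection_singleton`), `Q₀ = P_1 − P_{1/a}` has the package with `V(t) = log a · g(−t)`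
(`family_real`), so by resummation and subtraction `K_{{a}}(1)` has it with
`V(t) = (1 − a⁻¹) Σ a^{−(α+β)/2} log a · g(−t − (α−β) log a) − log a · g(−t) = Σ_{m ≥ 1} log a · a^{−m/2}
(g_t(m log a) + g_t(−m log a)) = connesLocalTerm a g_t`, `g_t = g(· − t)`. [cite: Connes1999, §VII Thm 4 and proof eqs. (29)–(33) (arXiv p0013)] -/
theorem decoupledFamily_singleton (a : ℕ) [hp : Fact a.Prime] (hg : IsWeilTest g) :
    ∃ C : ℝ,
    (∀ (M t : ℝ) (ι : Type) (f : HilbertBasis ι ℂ (evenPart : Submodule ℂ (Lp ℂ 2 (volume : Measure ℝ)))),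
      Summable (fun i => ‖diagCoeff g (dualCutoffProj ∅ M * (ContinuousLinearMap.adjoint (twistUnitary {a}) * cutoffProj 1 * twistUnitary {a} - cutoffProj 1) * scalingUnitary t)
        ((f i : evenPart) : Lp ℂ 2 (volume : Measure ℝ))‖) ∧
      ∑' i, ‖diagCoeff g (dualCutoffProj ∅ M * (ContinuousLinearMap.adjoint (twistUnitary {a}) * cutoffProj 1 * twistUnitary {a} - cutoffProj 1) * scalingUnitary t)
        ((f i : evenPart) : Lp ℂ 2 (volume : Measure ℝ))‖ ≤ C) ∧
    (∀ (M t : ℝ) (ι : Type) (f : HilbertBasis ι ℂ (evenPart : Submodule ℂ (Lp ℂ 2 (volume : Measure ℝ))))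
      (ι' : Type) (f' : HilbertBasis ι' ℂ (evenPart : Submodule ℂ (Lp ℂ 2 (volume : Measure ℝ)))),
      ∑' i, diagCoeff g (dualCutoffProj ∅ M * (ContinuousLinearMap.adjoint (twistUnitary {a}) * cutoffProj 1 * twistUnitary {a} - cutoffProj 1) * scalingUnitary t)
          ((f i : evenPart) : Lp ℂ 2 (volume : Measure ℝ)) =
        ∑' i, diagCoeff g (dualCutoffProj ∅ M * (ContinuousLinearMap.adjoint (twistUnitary {a}) * cutoffProj 1 * twistUnitary {a} - cutoffProj 1) * scalingUnitary t)
          ((f' i : evenPart) : Lp ℂ 2 (volume : Measure ℝ))) ∧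
    (∀ (t : ℝ) (ι : Type) (f : HilbertBasis ι ℂ (evenPart : Submodule ℂ (Lp ℂ 2 (volume : Measure ℝ)))),
      Tendsto (fun M : ℝ => ∑' i,
          diagCoeff g (dualCutoffProj ∅ M * (ContinuousLinearMap.adjoint (twistUnitary {a}) * cutoffProj 1 * twistUnitary {a} - cutoffProj 1) * scalingUnitary t)
            ((f i : evenPart) : Lp ℂ 2 (volume : Measure ℝ)))
        atTop (𝓝 (connesLocalTerm a (fun x => g (x - t))))) := by
  obtain ⟨Bd, hBd⟩ := hg.1.continuous.bounded_above_of_compact_support hg.2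
  have hQ := family_real a hg
  have hR := decoupledFamily_resum a hQ (hasSum_cutoffCorrection_singleton a 1)
  have hK := decoupledFamily_sub hR hQ
  rw [add_sub_cancel_right] at hK
  refine decoupledFamily_congr (fun t => ?_) hK
  show (∑' ab : ℕ × ℕ, ((1 - (a : ℂ)⁻¹) * (((Real.sqrt a)⁻¹ : ℝ) : ℂ) ^ (ab.1 + ab.2)) *
      ((Real.log a : ℂ) * g (-(t + ((ab.1 : ℝ) - ab.2) * Real.log a)))) - (Real.log a : ℂ) * g (-t) =
    connesLocalTerm a (fun x => g (x - t))
  have h := hasSum_annulus_pair_connesLocalTerm (p := a) hp.out.two_le (fun x => g (-x - t)) (fun x => hBd _)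
  have hsummand : ∀ ab : ℕ × ℕ, ((1 - (a : ℂ)⁻¹) * (((Real.sqrt a)⁻¹ : ℝ) : ℂ) ^ (ab.1 + ab.2)) *
      ((Real.log a : ℂ) * g (-(t + ((ab.1 : ℝ) - ab.2) * Real.log a))) =
      ((1 - (a : ℝ)⁻¹) * (Real.sqrt a)⁻¹ ^ (ab.1 + ab.2)) •
        ((Real.log a : ℂ) * g (-((((ab.1 : ℤ) - ab.2 : ℤ) : ℝ) * Real.log a) - t)) := fun ab => by
    have harg : -(t + ((ab.1 : ℝ) - ab.2) * Real.log a) = -((((ab.1 : ℤ) - ab.2 : ℤ) : ℝ) * Real.log a) - t := by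
      push_cast; ring
    rw [harg, Complex.real_smul]
    push_cast
    ring
  have hneg := connesLocalTerm_comp_neg a (fun y => g (y - t))
  simp_rw [hsummand]
  rw [h.tsum_eq, hneg]
  simp only [neg_zero, zero_sub]
  ring

end OnePrime

/-! ## §4. Several primes: `K_{A ∪ {a}}(1) = K_A(1) + u_A^* K_{{a}}(1) u_A` and the induction -/

section SeveralPrimes

variable {g : ℝ → ℂ}

/-- `u_A^*` commutes with the scaling group (as `u_A` does, `u_A` unitary). [cite: ConnesConsaniMoscovici2024, Prop. 4.2 (ii) §4.2 p. 18] -/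
theorem adjoint_twistUnitary_mul_scalingUnitary (A : Finset ℕ) (σ : ℝ) :
    ContinuousLinearMap.adjoint (twistUnitary A) * scalingUnitary σ =
      scalingUnitary σ * ContinuousLinearMap.adjoint (twistUnitary A) := by
  have h1 := adjoint_twistUnitary_mul_self A
  have h2 := twistUnitary_mul_adjoint_self A
  have hc := (commute_twistUnitary_scalingUnitary A σ).eq
  calc ContinuousLinearMap.adjoint (twistUnitary A) * scalingUnitary σ
      = ContinuousLinearMap.adjoint (twistUnitary A) * scalingUnitary σ *
          (twistUnitary A * ContinuousLinearMap.adjoint (twistUnitary A)) := by rw [h2, mul_one]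
    _ = ContinuousLinearMap.adjoint (twistUnitary A) * (scalingUnitary σ * twistUnitary A) *
          ContinuousLinearMap.adjoint (twistUnitary A) := by simp only [mul_assoc]
    _ = ContinuousLinearMap.adjoint (twistUnitary A) * (twistUnitary A * scalingUnitary σ) *
          ContinuousLinearMap.adjoint (twistUnitary A) := by rw [hc]
    _ = (ContinuousLinearMap.adjoint (twistUnitary A) * twistUnitary A) * scalingUnitary σ *
          ContinuousLinearMap.adjoint (twistUnitary A) := by simp only [mul_assoc]
    _ = scalingUnitary σ * ContinuousLinearMap.adjoint (twistUnitary A) := by rw [h1, one_mul]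

/-- **`K_A(1/a) = ϑ_{−log a} K_A(1) ϑ_{log a}`** (`P_{1/a} = ϑ_{−log a} P_1 ϑ_{log a}`, `u_A` commutes with
the scaling group). [cite: Connes1999, §V eqs. (15)–(16), §VII eq. (12) (arXiv p0013)] -/
theorem cutoffCorrection_inv_eq_conj (A : Finset ℕ) (a : ℕ) [hp : Fact a.Prime] :
    (ContinuousLinearMap.adjoint (twistUnitary A) * cutoffProj (1 / (a : ℝ)) * twistUnitary A - cutoffProj (1 / (a : ℝ))) =
      scalingUnitary (-Real.log a) *
        (ContinuousLinearMap.adjoint (twistUnitary A) * cutoffProj 1 * twistUnitary A - cutoffProj 1) *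
        scalingUnitary (Real.log a) := by
  have ha0 : (0 : ℝ) < a := by exact_mod_cast hp.out.pos
  have hP : cutoffProj (1 / (a : ℝ)) =
      scalingUnitary (-Real.log a) * cutoffProj 1 * scalingUnitary (Real.log a) := by
    have h := cutoffProj_eq_conj (1 / (a : ℝ)) (-Real.log a)
    rw [neg_neg, Real.exp_log ha0, one_div_mul_cancel ha0.ne'] at h
    exact h
  have hc1 := adjoint_twistUnitary_mul_scalingUnitary A (-Real.log a)
  have hc2 := (commute_twistUnitary_scalingUnitary A (Real.log a)).eq
  rw [hP]
  calc ContinuousLinearMap.adjoint (twistUnitary A) *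
        (scalingUnitary (-Real.log a) * cutoffProj 1 * scalingUnitary (Real.log a)) * twistUnitary A -
        scalingUnitary (-Real.log a) * cutoffProj 1 * scalingUnitary (Real.log a)
      = (ContinuousLinearMap.adjoint (twistUnitary A) * scalingUnitary (-Real.log a)) * cutoffProj 1 *
          (scalingUnitary (Real.log a) * twistUnitary A) -
          scalingUnitary (-Real.log a) * cutoffProj 1 * scalingUnitary (Real.log a) := by
        simp only [mul_assoc]
    _ = (scalingUnitary (-Real.log a) * ContinuousLinearMap.adjoint (twistUnitary A)) * cutoffProj 1 *
          (twistUnitary A * scalingUnitary (Real.log a)) -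
          scalingUnitary (-Real.log a) * cutoffProj 1 * scalingUnitary (Real.log a) := by rw [hc1, ← hc2]
    _ = scalingUnitary (-Real.log a) *
        (ContinuousLinearMap.adjoint (twistUnitary A) * cutoffProj 1 * twistUnitary A - cutoffProj 1) *
        scalingUnitary (Real.log a) := by simp only [mul_sub, sub_mul, mul_assoc]

/-- **`u_A^* Q₀ u_A = Q₀ + (K_A(1) − K_A(1/a))`** (`Q₀ = P_1 − P_{1/a}`, `u_A^* P_Λ u_A = P_Λ + K_A(Λ)`). [cite: Connes1999, §VII proof of Thm 4 eqs. (30)–(32) (arXiv p0013)] -/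
theorem adjoint_twistUnitary_mul_annulusProj_mul_twistUnitary (A : Finset ℕ) (a : ℕ) :
    ContinuousLinearMap.adjoint (twistUnitary A) * annulusProj a 1 * twistUnitary A =
      annulusProj a 1 +
        ((ContinuousLinearMap.adjoint (twistUnitary A) * cutoffProj 1 * twistUnitary A - cutoffProj 1) -
              (ContinuousLinearMap.adjoint (twistUnitary A) * cutoffProj (1 / (a : ℝ)) * twistUnitary A - cutoffProj (1 / (a : ℝ)))) := by
  rw [annulusProj_def]
  noncomm_ring

/-- **The resummed cross term**: with `D = K_A(1) − K_A(1/a)` and `Q₀' = K_{{a}}(1) + Q₀`,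
`Σ_{(α,β)} (1 − a⁻¹)a^{−(α+β)/2} ϑ_{α log a} D ϑ_{−β log a} = u_A^* Q₀' u_A − Q₀'` — conjugate the one-prime
expansion by the unitary `u_A` (which commutes with the scaling group) and subtract it. [cite: Connes1999, §VII proof of Thm 4 eqs. (29)–(33) (arXiv p0013)] -/
theorem hasSum_dilated_cutoffCorrection_diff (A : Finset ℕ) (a : ℕ) [hp : Fact a.Prime] :
    HasSum (fun ab : ℕ × ℕ => ((1 - (a : ℂ)⁻¹) * (((Real.sqrt a)⁻¹ : ℝ) : ℂ) ^ (ab.1 + ab.2)) •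
        (scalingUnitary (ab.1 * Real.log a) *
          ((ContinuousLinearMap.adjoint (twistUnitary A) * cutoffProj 1 * twistUnitary A - cutoffProj 1) -
              (ContinuousLinearMap.adjoint (twistUnitary A) * cutoffProj (1 / (a : ℝ)) * twistUnitary A - cutoffProj (1 / (a : ℝ)))) *
          scalingUnitary (ab.2 * (-Real.log a))))
      (ContinuousLinearMap.adjoint (twistUnitary A) *
          ((ContinuousLinearMap.adjoint (twistUnitary {a}) * cutoffProj 1 * twistUnitary {a} - cutoffProj 1) + annulusProj a 1) * twistUnitary A -
        ((ContinuousLinearMap.adjoint (twistUnitary {a}) * cutoffProj 1 * twistUnitary {a} - cutoffProj 1) + annulusProj a 1)) := by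
  have hKQ := hasSum_cutoffCorrection_singleton a 1
  have h' := (hKQ.mul_left (ContinuousLinearMap.adjoint (twistUnitary A))).mul_right (twistUnitary A)
  have hQ := adjoint_twistUnitary_mul_annulusProj_mul_twistUnitary A a
  have hterm : ∀ ab : ℕ × ℕ,
      ContinuousLinearMap.adjoint (twistUnitary A) * (((1 - (a : ℂ)⁻¹) * (((Real.sqrt a)⁻¹ : ℝ) : ℂ) ^ (ab.1 + ab.2)) •
        (scalingUnitary (ab.1 * Real.log a) * annulusProj a 1 * scalingUnitary (ab.2 * (-Real.log a)))) *
        twistUnitary A =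
      ((1 - (a : ℂ)⁻¹) * (((Real.sqrt a)⁻¹ : ℝ) : ℂ) ^ (ab.1 + ab.2)) •
        (scalingUnitary (ab.1 * Real.log a) * annulusProj a 1 * scalingUnitary (ab.2 * (-Real.log a))) +
      ((1 - (a : ℂ)⁻¹) * (((Real.sqrt a)⁻¹ : ℝ) : ℂ) ^ (ab.1 + ab.2)) •
        (scalingUnitary (ab.1 * Real.log a) *
          ((ContinuousLinearMap.adjoint (twistUnitary A) * cutoffProj 1 * twistUnitary A - cutoffProj 1) -
              (ContinuousLinearMap.adjoint (twistUnitary A) * cutoffProj (1 / (a : ℝ)) * twistUnitary A - cutoffProj (1 / (a : ℝ)))) *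
          scalingUnitary (ab.2 * (-Real.log a))) := fun ab => by
    rw [mul_smul_comm, smul_mul_assoc, ← smul_add]
    congr 1
    have hc1 := adjoint_twistUnitary_mul_scalingUnitary A (ab.1 * Real.log a)
    have hc2 := (commute_twistUnitary_scalingUnitary A (ab.2 * (-Real.log a))).eq
    calc ContinuousLinearMap.adjoint (twistUnitary A) *
          (scalingUnitary (ab.1 * Real.log a) * annulusProj a 1 * scalingUnitary (ab.2 * (-Real.log a))) *
          twistUnitary A
        = (ContinuousLinearMap.adjoint (twistUnitary A) * scalingUnitary (ab.1 * Real.log a)) * annulusProj a 1 *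
            (scalingUnitary (ab.2 * (-Real.log a)) * twistUnitary A) := by simp only [mul_assoc]
      _ = (scalingUnitary (ab.1 * Real.log a) * ContinuousLinearMap.adjoint (twistUnitary A)) * annulusProj a 1 *
            (twistUnitary A * scalingUnitary (ab.2 * (-Real.log a))) := by rw [hc1, ← hc2]
      _ = scalingUnitary (ab.1 * Real.log a) *
            (ContinuousLinearMap.adjoint (twistUnitary A) * annulusProj a 1 * twistUnitary A) *
            scalingUnitary (ab.2 * (-Real.log a)) := by simp only [mul_assoc]
      _ = scalingUnitary (ab.1 * Real.log a) * (annulusProj a 1 +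
            ((ContinuousLinearMap.adjoint (twistUnitary A) * cutoffProj 1 * twistUnitary A - cutoffProj 1) -
              (ContinuousLinearMap.adjoint (twistUnitary A) * cutoffProj (1 / (a : ℝ)) * twistUnitary A - cutoffProj (1 / (a : ℝ))))) *
            scalingUnitary (ab.2 * (-Real.log a)) := by rw [hQ]
      _ = _ := by rw [mul_add, add_mul]
  simp_rw [hterm] at h'
  simpa only [add_sub_cancel_left] using h'.sub hKQ

/-- **Induction step.**  If `K_A(1)` has the package with limits `V` and `a ∉ A` is a prime, then
`K_{A ∪ {a}}(1)` has the package with limits `V(t) + ∫′_{ℚ_a^*} g(· − t)`: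
`K_{A∪{a}}(1) = K_A(1) + u_A^* K_{{a}}(1) u_A` and `u_A^* K_{{a}}(1) u_A = D' + K_{{a}}(1) − D` with
`D = K_A(1) − K_A(1/a)` (limits `V − V = 0`) and `D'` its resummation (limits `0`). [cite: Connes1999, §VII proof of Thm 4 eqs. (29)–(33) (arXiv p0013)] -/
theorem decoupledFamily_insert (hg : IsWeilTest g) {a : ℕ} [hp : Fact a.Prime] {A : Finset ℕ} (haA : a ∉ A)
    {V : ℝ → ℂ}
    (hA : ∃ C : ℝ,
    (∀ (M t : ℝ) (ι : Type) (f : HilbertBasis ι ℂ (evenPart : Submodule ℂ (Lp ℂ 2 (volume : Measure ℝ)))),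
      Summable (fun i => ‖diagCoeff g (dualCutoffProj ∅ M * (ContinuousLinearMap.adjoint (twistUnitary A) * cutoffProj 1 * twistUnitary A - cutoffProj 1) * scalingUnitary t)
        ((f i : evenPart) : Lp ℂ 2 (volume : Measure ℝ))‖) ∧
      ∑' i, ‖diagCoeff g (dualCutoffProj ∅ M * (ContinuousLinearMap.adjoint (twistUnitary A) * cutoffProj 1 * twistUnitary A - cutoffProj 1) * scalingUnitary t)
        ((f i : evenPart) : Lp ℂ 2 (volume : Measure ℝ))‖ ≤ C) ∧
    (∀ (M t : ℝ) (ι : Type) (f : HilbertBasis ι ℂ (evenPart : Submodule ℂ (Lp ℂ 2 (volume : Measure ℝ))))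
      (ι' : Type) (f' : HilbertBasis ι' ℂ (evenPart : Submodule ℂ (Lp ℂ 2 (volume : Measure ℝ)))),
      ∑' i, diagCoeff g (dualCutoffProj ∅ M * (ContinuousLinearMap.adjoint (twistUnitary A) * cutoffProj 1 * twistUnitary A - cutoffProj 1) * scalingUnitary t)
          ((f i : evenPart) : Lp ℂ 2 (volume : Measure ℝ)) =
        ∑' i, diagCoeff g (dualCutoffProj ∅ M * (ContinuousLinearMap.adjoint (twistUnitary A) * cutoffProj 1 * twistUnitary A - cutoffProj 1) * scalingUnitary t)
          ((f' i : evenPart) : Lp ℂ 2 (volume : Measure ℝ))) ∧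
    (∀ (t : ℝ) (ι : Type) (f : HilbertBasis ι ℂ (evenPart : Submodule ℂ (Lp ℂ 2 (volume : Measure ℝ)))),
      Tendsto (fun M : ℝ => ∑' i,
          diagCoeff g (dualCutoffProj ∅ M * (ContinuousLinearMap.adjoint (twistUnitary A) * cutoffProj 1 * twistUnitary A - cutoffProj 1) * scalingUnitary t)
            ((f i : evenPart) : Lp ℂ 2 (volume : Measure ℝ)))
        atTop (𝓝 (V t)))) :
    ∃ C : ℝ,
    (∀ (M t : ℝ) (ι : Type) (f : HilbertBasis ι ℂ (evenPart : Submodule ℂ (Lp ℂ 2 (volume : Measure ℝ)))),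
      Summable (fun i => ‖diagCoeff g (dualCutoffProj ∅ M * (ContinuousLinearMap.adjoint (twistUnitary (insert a A)) * cutoffProj 1 * twistUnitary (insert a A) - cutoffProj 1) * scalingUnitary t)
        ((f i : evenPart) : Lp ℂ 2 (volume : Measure ℝ))‖) ∧
      ∑' i, ‖diagCoeff g (dualCutoffProj ∅ M * (ContinuousLinearMap.adjoint (twistUnitary (insert a A)) * cutoffProj 1 * twistUnitary (insert a A) - cutoffProj 1) * scalingUnitary t)
        ((f i : evenPart) : Lp ℂ 2 (volume : Measure ℝ))‖ ≤ C) ∧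
    (∀ (M t : ℝ) (ι : Type) (f : HilbertBasis ι ℂ (evenPart : Submodule ℂ (Lp ℂ 2 (volume : Measure ℝ))))
      (ι' : Type) (f' : HilbertBasis ι' ℂ (evenPart : Submodule ℂ (Lp ℂ 2 (volume : Measure ℝ)))),
      ∑' i, diagCoeff g (dualCutoffProj ∅ M * (ContinuousLinearMap.adjoint (twistUnitary (insert a A)) * cutoffProj 1 * twistUnitary (insert a A) - cutoffProj 1) * scalingUnitary t)
          ((f i : evenPart) : Lp ℂ 2 (volume : Measure ℝ)) =
        ∑' i, diagCoeff g (dualCutoffProj ∅ M * (ContinuousLinearMap.adjoint (twistUnitary (insert a A)) * cutoffProj 1 * twistUnitary (insert a A) - cutoffProj 1) * scalingUnitary t)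
          ((f' i : evenPart) : Lp ℂ 2 (volume : Measure ℝ))) ∧
    (∀ (t : ℝ) (ι : Type) (f : HilbertBasis ι ℂ (evenPart : Submodule ℂ (Lp ℂ 2 (volume : Measure ℝ)))),
      Tendsto (fun M : ℝ => ∑' i,
          diagCoeff g (dualCutoffProj ∅ M * (ContinuousLinearMap.adjoint (twistUnitary (insert a A)) * cutoffProj 1 * twistUnitary (insert a A) - cutoffProj 1) * scalingUnitary t)
            ((f i : evenPart) : Lp ℂ 2 (volume : Measure ℝ)))
        atTop (𝓝 (V t + connesLocalTerm a (fun x => g (x - t))))) := by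
  -- `D = K_A(1) − K_A(1/a)` has the package with limits `0`
  have hAinv := decoupledFamily_congr_op (cutoffCorrection_inv_eq_conj A a).symm
    (decoupledFamily_conj (g := g) (Real.log a) hA)
  have hD := decoupledFamily_congr (V' := fun _ => 0) (fun t => sub_self (V t)) (decoupledFamily_sub hA hAinv)
  -- its resummation `D'` has the package with limits `0`
  have hD' := decoupledFamily_congr (V' := fun _ => 0)
    (fun t => by simp only [mul_zero, tsum_zero])
    (decoupledFamily_resum a hD (hasSum_dilated_cutoffCorrection_diff A a))
  -- the one-prime package
  have hKa := decoupledFamily_singleton a hg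
  -- `u_A^* K_a(1) u_A = D' + K_a(1) − D`
  have hop : ContinuousLinearMap.adjoint (twistUnitary A) *
        (ContinuousLinearMap.adjoint (twistUnitary {a}) * cutoffProj 1 * twistUnitary {a} - cutoffProj 1) * twistUnitary A =
      ContinuousLinearMap.adjoint (twistUnitary A) *
          ((ContinuousLinearMap.adjoint (twistUnitary {a}) * cutoffProj 1 * twistUnitary {a} - cutoffProj 1) + annulusProj a 1) * twistUnitary A -
        ((ContinuousLinearMap.adjoint (twistUnitary {a}) * cutoffProj 1 * twistUnitary {a} - cutoffProj 1) + annulusProj a 1) +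
      (ContinuousLinearMap.adjoint (twistUnitary {a}) * cutoffProj 1 * twistUnitary {a} - cutoffProj 1) -
      ((ContinuousLinearMap.adjoint (twistUnitary A) * cutoffProj 1 * twistUnitary A - cutoffProj 1) -
              (ContinuousLinearMap.adjoint (twistUnitary A) * cutoffProj (1 / (a : ℝ)) * twistUnitary A - cutoffProj (1 / (a : ℝ)))) := by
    rw [annulusProj_def]
    noncomm_ring
  have h3 := decoupledFamily_congr_op hop.symm (decoupledFamily_sub (decoupledFamily_add hD' hKa) hD)
  have h4 := decoupledFamily_congr_op (cutoffCorrection_insert haA 1).symm (decoupledFamily_add hA h3)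
  refine decoupledFamily_congr (fun t => ?_) h4
  simp only [zero_add, sub_zero]

/-- **All finite sets of primes**: `K_P(1) = u_P^* P_1 u_P − P_1` has the package with limits
`Σ_{p ∈ P} ∫′_{ℚ_p^*} g(· − t)` (induction on `P` from `K_∅ = 0`). [cite: Connes1999, §VII Thm 4 and proof eqs. (29)–(33) (arXiv p0013)] -/
theorem decoupledFamily_annulusCorrection (hg : IsWeilTest g) (P : Finset ℕ) (hP : ∀ p ∈ P, p.Prime) :
    ∃ C : ℝ,
    (∀ (M t : ℝ) (ι : Type) (f : HilbertBasis ι ℂ (evenPart : Submodule ℂ (Lp ℂ 2 (volume : Measure ℝ)))),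
      Summable (fun i => ‖diagCoeff g (dualCutoffProj ∅ M * (ContinuousLinearMap.adjoint (twistUnitary P) * cutoffProj 1 * twistUnitary P - cutoffProj 1) * scalingUnitary t)
        ((f i : evenPart) : Lp ℂ 2 (volume : Measure ℝ))‖) ∧
      ∑' i, ‖diagCoeff g (dualCutoffProj ∅ M * (ContinuousLinearMap.adjoint (twistUnitary P) * cutoffProj 1 * twistUnitary P - cutoffProj 1) * scalingUnitary t)
        ((f i : evenPart) : Lp ℂ 2 (volume : Measure ℝ))‖ ≤ C) ∧
    (∀ (M t : ℝ) (ι : Type) (f : HilbertBasis ι ℂ (evenPart : Submodule ℂ (Lp ℂ 2 (volume : Measure ℝ))))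
      (ι' : Type) (f' : HilbertBasis ι' ℂ (evenPart : Submodule ℂ (Lp ℂ 2 (volume : Measure ℝ)))),
      ∑' i, diagCoeff g (dualCutoffProj ∅ M * (ContinuousLinearMap.adjoint (twistUnitary P) * cutoffProj 1 * twistUnitary P - cutoffProj 1) * scalingUnitary t)
          ((f i : evenPart) : Lp ℂ 2 (volume : Measure ℝ)) =
        ∑' i, diagCoeff g (dualCutoffProj ∅ M * (ContinuousLinearMap.adjoint (twistUnitary P) * cutoffProj 1 * twistUnitary P - cutoffProj 1) * scalingUnitary t)
          ((f' i : evenPart) : Lp ℂ 2 (volume : Measure ℝ))) ∧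
    (∀ (t : ℝ) (ι : Type) (f : HilbertBasis ι ℂ (evenPart : Submodule ℂ (Lp ℂ 2 (volume : Measure ℝ)))),
      Tendsto (fun M : ℝ => ∑' i,
          diagCoeff g (dualCutoffProj ∅ M * (ContinuousLinearMap.adjoint (twistUnitary P) * cutoffProj 1 * twistUnitary P - cutoffProj 1) * scalingUnitary t)
            ((f i : evenPart) : Lp ℂ 2 (volume : Measure ℝ)))
        atTop (𝓝 (∑ q ∈ P, connesLocalTerm q (fun x => g (x - t))))) := by
  induction P using Finset.induction_on with
  | empty =>
    refine decoupledFamily_congr (fun t => ?_)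
      (decoupledFamily_congr_op (annulusCorrection_empty 1).symm (decoupledFamily_zero g))
    rw [Finset.sum_empty]
  | insert a A haA ih =>
    haveI : Fact a.Prime := ⟨hP a (Finset.mem_insert_self a A)⟩
    have hA := ih fun q hq => hP q (Finset.mem_insert_of_mem hq)
    refine decoupledFamily_congr (fun t => ?_) (decoupledFamily_insert hg haA hA)
    rw [Finset.sum_insert haA, add_comm]

end SeveralPrimes

/-! ## §5. Back to the coupled cutoff `P̂⁰_Λ K_P(Λ)` and the named fact -/

section Door

variable {g : ℝ → ℂ}

/-- **`P̂⁰_Λ K_P(Λ) = ϑ_{log Λ} (P̂⁰_{Λ²} K_P(1) ϑ_0) ϑ_{−log Λ}`** (`Λ > 0`): `P_Λ = ϑ_{log Λ} P_1 ϑ_{−log Λ}`,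
`u_P` commutes with the scaling group, `P̂⁰_Λ ϑ_{log Λ} = ϑ_{log Λ} P̂⁰_{Λ²}`. [cite: Connes1999, §V eqs. (15)–(16), §VII eqs. (12)–(13) and proof of Thm 4 eq. (29) (arXiv p0013)] -/
theorem dualCutoffProj_mul_cutoffCorrection_eq_conj (P : Finset ℕ) {Λ : ℝ} (hΛ : 0 < Λ) :
    dualCutoffProj ∅ Λ * (ContinuousLinearMap.adjoint (twistUnitary P) * cutoffProj Λ * twistUnitary P - cutoffProj Λ) =
      scalingUnitary (Real.log Λ) * (dualCutoffProj ∅ (Λ ^ 2) *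
        (ContinuousLinearMap.adjoint (twistUnitary P) * cutoffProj 1 * twistUnitary P - cutoffProj 1) * scalingUnitary 0) *
        scalingUnitary (-Real.log Λ) := by
  have hPΛ : cutoffProj Λ = scalingUnitary (Real.log Λ) * cutoffProj 1 * scalingUnitary (-Real.log Λ) := by
    rw [cutoffProj_eq_conj Λ (Real.log Λ), Real.exp_neg, Real.exp_log hΛ, mul_inv_cancel₀ hΛ.ne']
  have hc1 := adjoint_twistUnitary_mul_scalingUnitary P (Real.log Λ)
  have hc2 := (commute_twistUnitary_scalingUnitary P (-Real.log Λ)).eq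
  have hK : (ContinuousLinearMap.adjoint (twistUnitary P) * cutoffProj Λ * twistUnitary P - cutoffProj Λ) =
      scalingUnitary (Real.log Λ) * (ContinuousLinearMap.adjoint (twistUnitary P) * cutoffProj 1 * twistUnitary P - cutoffProj 1) *
        scalingUnitary (-Real.log Λ) := by
    rw [hPΛ]
    calc ContinuousLinearMap.adjoint (twistUnitary P) *
          (scalingUnitary (Real.log Λ) * cutoffProj 1 * scalingUnitary (-Real.log Λ)) * twistUnitary P -
          scalingUnitary (Real.log Λ) * cutoffProj 1 * scalingUnitary (-Real.log Λ)
        = (ContinuousLinearMap.adjoint (twistUnitary P) * scalingUnitary (Real.log Λ)) * cutoffProj 1 *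
            (scalingUnitary (-Real.log Λ) * twistUnitary P) -
            scalingUnitary (Real.log Λ) * cutoffProj 1 * scalingUnitary (-Real.log Λ) := by
          simp only [mul_assoc]
      _ = (scalingUnitary (Real.log Λ) * ContinuousLinearMap.adjoint (twistUnitary P)) * cutoffProj 1 *
            (twistUnitary P * scalingUnitary (-Real.log Λ)) -
            scalingUnitary (Real.log Λ) * cutoffProj 1 * scalingUnitary (-Real.log Λ) := by rw [hc1, ← hc2]
      _ = scalingUnitary (Real.log Λ) * (ContinuousLinearMap.adjoint (twistUnitary P) * cutoffProj 1 * twistUnitary P - cutoffProj 1) *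
            scalingUnitary (-Real.log Λ) := by simp only [mul_sub, sub_mul, mul_assoc]
  have hD : dualCutoffProj ∅ Λ * scalingUnitary (Real.log Λ) =
      scalingUnitary (Real.log Λ) * dualCutoffProj ∅ (Λ ^ 2) := by
    rw [dualCutoffProj_empty_mul_scalingUnitary, Real.exp_log hΛ, sq]
  rw [hK, scalingUnitary_zero, mul_one]
  calc dualCutoffProj ∅ Λ * (scalingUnitary (Real.log Λ) * (ContinuousLinearMap.adjoint (twistUnitary P) * cutoffProj 1 * twistUnitary P - cutoffProj 1) *
        scalingUnitary (-Real.log Λ))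
      = (dualCutoffProj ∅ Λ * scalingUnitary (Real.log Λ)) * (ContinuousLinearMap.adjoint (twistUnitary P) * cutoffProj 1 * twistUnitary P - cutoffProj 1) *
          scalingUnitary (-Real.log Λ) := by simp only [mul_assoc]
    _ = (scalingUnitary (Real.log Λ) * dualCutoffProj ∅ (Λ ^ 2)) * (ContinuousLinearMap.adjoint (twistUnitary P) * cutoffProj 1 * twistUnitary P - cutoffProj 1) *
          scalingUnitary (-Real.log Λ) := by rw [hD]
    _ = _ := by simp only [mul_assoc]

/-- Diagonal form: `d_g(P̂⁰_Λ K_P(Λ), f_i) = d_g(P̂⁰_{Λ²} K_P(1) ϑ_0, f'_i)`, `f' = f.scalingConj (log Λ)`. [cite: Connes1999, §VII proof of Thm 4 eq. (29) (arXiv p0013)] -/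
theorem diagCoeff_dualCutoffProj_mul_cutoffCorrection_eq (P : Finset ℕ) (g : ℝ → ℂ) {Λ : ℝ} (hΛ : 0 < Λ)
    {ι : Type*} (f : HilbertBasis ι ℂ (evenPart : Submodule ℂ (Lp ℂ 2 (volume : Measure ℝ)))) (i : ι) :
    diagCoeff g (dualCutoffProj ∅ Λ * (ContinuousLinearMap.adjoint (twistUnitary P) * cutoffProj Λ * twistUnitary P - cutoffProj Λ))
        ((f i : evenPart) : Lp ℂ 2 (volume : Measure ℝ)) =
      diagCoeff g (dualCutoffProj ∅ (Λ ^ 2) * (ContinuousLinearMap.adjoint (twistUnitary P) * cutoffProj 1 * twistUnitary P - cutoffProj 1) *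
          scalingUnitary 0)
        ((f.scalingConj (Real.log Λ) i : evenPart) : Lp ℂ 2 (volume : Measure ℝ)) := by
  rw [dualCutoffProj_mul_cutoffCorrection_eq_conj P hΛ, diagCoeff_conj_scalingUnitary]

/-- **Connes 1999, Theorem VII.4 for `k = ℚ`, `S = {∞} ∪ P`, `K_S`-invariant picture — PROVED**: the
Literature fact `Connes1999_thm_VII_4_rat` holds.  For every finite set of primes `P`, every Weil test function
`g` and every Hilbert basis `(e_i)` of `L²(ℝ)_ev`, the diagonal series of `ϑ(g) R_Λ^S` is summable for
`Λ > 0` and `Σ_i ⟨e_i, ϑ(g) R_Λ^S e_i⟩ = 2 log Λ · g(0) + Σ_{p ∈ P} ∫′_{ℚ_p^*} g + (archimedean term) + o(1)`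
as `Λ → ∞` (`connesSemilocalGeometricSide`).  Door `Connes1999_thm_VII_4_rat_of_annulusCorrection` with
`hsum`, `hlim` from the package of `K_P(1)` at `M = Λ²`, `t = 0`. [cite: Connes1999, §VII Thm 4 (arXiv p0013:L1); Connes2026Letter, §7.4 (arXiv p0025:L16)] -/
theorem Connes1999_thm_VII_4_rat_holds : Connes1999_thm_VII_4_rat := by
  refine Connes1999_thm_VII_4_rat_of_annulusCorrection fun P hP g hg => ?_
  obtain ⟨C, hB1, hB0, hB2⟩ := decoupledFamily_annulusCorrection hg P hP
  refine ⟨fun ι f Λ hΛ => ?_, fun ι f => ?_⟩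
  · refine (Summable.of_norm (hB1 (Λ ^ 2) 0 ι (f.scalingConj (Real.log Λ))).1).congr fun i => ?_
    exact (diagCoeff_dualCutoffProj_mul_cutoffCorrection_eq P g hΛ f i).symm
  · have hV : (∑ q ∈ P, connesLocalTerm q (fun x => g (x - 0))) = ∑ p ∈ P, connesLocalTerm p g := by
      simp only [sub_zero]
    have hlim : Tendsto (fun Λ : ℝ => ∑' i,
        diagCoeff g (dualCutoffProj ∅ (Λ ^ 2) * (ContinuousLinearMap.adjoint (twistUnitary P) * cutoffProj 1 * twistUnitary P - cutoffProj 1) *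
          scalingUnitary 0) ((f i : evenPart) : Lp ℂ 2 (volume : Measure ℝ)))
        atTop (𝓝 (∑ q ∈ P, connesLocalTerm q (fun x => g (x - 0)))) :=
      (hB2 0 ι f).comp (tendsto_pow_atTop two_ne_zero)
    rw [hV] at hlim
    refine hlim.congr' ?_
    filter_upwards [eventually_gt_atTop (0 : ℝ)] with Λ hΛ
    rw [hB0 (Λ ^ 2) 0 ι f ι (f.scalingConj (Real.log Λ))]
    exact tsum_congr fun i => (diagCoeff_dualCutoffProj_mul_cutoffCorrection_eq P g hΛ f i).symm

end Door

end Literature.NumberTheory.Connes2026
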